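import Literature.Probability.LatticeModels.FieldCurrents
import Literature.Probability.LatticeModels.MeanFieldLowerBound
import Literature.Barriers.HubbardSuperconductivity.WeakCouplingCeiling
import HarnessLib

/-!
# Duminil-Copin–Tassion's mean-field differential inequality (Lemma 2.6, corrected) — proved

Trunk G02 (T-STATMECH), topic `Probability/LatticeModels`; namespaces `Literature.StatMech` (the
random-current argument on a general locally finite graph) and `Literature.CritIsing` (the `ℤ^d`
statement). This file **discharges the named fact `dct_meanField_differentialInequality`** of
`MeanFieldLowerBound` (`dct_meanField_differentialInequality_holds`):
for the nearest-neighbour Ising model on `ℤ^d`, `d ≥ 1`, `β > 0`, `h > 0`, `Λ ∋ 0` finite,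

  `d/dβ ⟨σ₀⟩²_{Λ,β,h} ≥ (2c(Λ)/β) (inf_{S ∋ 0} φ_β(S)) (1 - ⟨σ₀⟩²_{Λ,β,h}) - ε(Λ,β,h)`,

Duminil-Copin–Tassion, CMP 343 (2016) 725, Lemma 2.6 (numbering of arXiv:1502.03050), as
corrected in CMP 359 (2018) 821. Together with `MeanFieldAveraged`
(`twoPoint_exponentialDecay_of_differentialInequality`, which needs only this fact) it completes
the proof of crit-ising.S08 (`twoPoint_exponentialDecay_of_lt_criticalBeta`) and of eq. (2.6)
(`dct_magnetization_lower_bound`) along Duminil-Copin–Tassion's argument.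

## The proof (Duminil-Copin–Tassion 2016, §2.4, with the tools of `FieldCurrents`)

All currents live on the edges of the ghost graph `ghostGraph G Λ` inside `Λ ∪ {g}` (couplings
`β` on the edges of `G`, `βh` on the ghost edges, tree parametrisation of the field); pair sums
`∑_{∂n₁ = X, ∂n₂ = Y} w(n₁)w(n₂)F(n₁+n₂)` are `currentPairSum`, valued in `ℝ≥0∞`.

1. `hasDerivAt_isingCorr_singleton_dctParam`: in DCT's parametrisation (`⟨·⟩_{Λ,s,h/s}`),
   `d/dβ ⟨σ_o⟩ = ∑_{xy ∈ ℰ_Λ} (⟨σ_oσ_xσ_y⟩ - ⟨σ_o⟩⟨σ_xσ_y⟩)` (first display of the proof).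
2. `isingCorr_triple_sub_eq` (eq. (2.11)): by the representation (2.2) and the switching lemma,
   `⟨σ_oσ_xσ_y⟩ - ⟨σ_o⟩⟨σ_xσ_y⟩ = Z⁻² ∑_{∂n₁ = {o,g}∆{x,y}, ∂n₂ = ∅} w w 𝟙[o ↮ g]`.
3. `xor_cconn_of_csources_eq`, `currentPairSum_notConn_eq_dctDelta_add` (eq. (2.12)): exactly
   one of `x, y` is connected to `o` (parity of the sources of `n₁` in the cluster of `o`), so the
   sum is `δ_{x,y} + δ_{y,x}` (`dctDelta`).
4. `currentPairSum_clusterCompl_eq`: the factorisation of a pair sum on `{𝒮_b(n₁+n₂) = S}` into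
   currents inside `S` and currents inside the complement (both Claims).
5. `claim1_fixed`, `claim1` (Claim 1 and (2.13)): decompose `δ_{x,y}` over `𝒮_o = S`
   (`g, y ∈ S`, `o, x ∉ S`), factorise, compare `⟨σ_y⟩_{S∖{g}} ≤ ⟨σ_y⟩_Λ` (Griffiths, (2.4)),
   refactorise and switch `{y,g}`: `Z(∅)·∑_{({o}∆{x})*,∅} w w 𝟙[o ↮ g, y ⟷ g] ≤ Z({y}*)·δ_{x,y}`.
6. `claim2`, `currentPairSum_notConn_conn_eq_sum` (Claim 2 and the decomposition over `𝒮_g`):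
   on `{𝒮_g = S'}` with `o, x ∈ S'` the sources `{o} ∆ {x}` live in the zero-field model in
   `S'`: `∑_{({o}∆{x})*,∅} w w 𝟙[𝒮_g = S'] = ⟨σ_oσ_x⟩_{S',β,0} W(S')` (`dctW S' = ∑_{∅,∅} w w 𝟙[𝒮_g = S']`).
7. `meanField_core`: with `c ⟨σ_y⟩ ≤ ⟨σ_o⟩` (`c = c(Λ)`), summing over ordered adjacent pairs
   (`sum_adj_eq_sum_edgesIn`) — **with `y ∈ Λ ∖ S'` only**, as the 2018 Correction prescribes —
   `c ∑_{S' ∋ o} Z⁻²W(S') ∑_{x ∈ S'} ∑_{y ∈ Λ∖S', y ∼ x} ⟨σ_oσ_x⟩_{S',β,0} ≤ ⟨σ_o⟩ · D`,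
   `D` the edge sum of item 1.
8. `sum_dctW_toReal_eq`: `Z⁻² ∑_{S' ∋ o} W(S') = 1 - ⟨σ_o⟩²` (switching once more);
   `sum_isingCorr_zero_mul_dctW_eq`: `Z⁻² ∑_{S' ∋ o,x} ⟨σ_oσ_x⟩_{S',β,0} W(S') = ⟨σ_oσ_x⟩ - ⟨σ_o⟩⟨σ_x⟩`
   (Claim 2 summed over `S'`, then switching), which turns the missing `y ∉ Λ` part of `φ_β(S')`
   into the correcting term `ε(Λ,β,h) = 2 ∑_x #{y ∼ x, y ∉ Λ} ⟨σ₀;σ_x⟩`.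
9. `dct_meanField_differentialInequality_holds`: `tanh β ≤ β`, `c(Λ) ≤ 1`, `φ_β(S') ≥ inf`, and
   the arithmetic of (2.14).

## References

* H. Duminil-Copin, V. Tassion, CMP 343 (2016) 725–745, §2.3–2.4, Lemma 2.6 (arXiv:1502.03050
  numbering); Correction, CMP 359 (2018) 821–822.
* M. Aizenman, D. J. Barsky, R. Fernández, J. Stat. Phys. 47 (1987) 343–374 ("we use a
  computation similar to one provided in [AizBarFer87]").
* R. B. Griffiths, C. A. Hurst, S. Sherman, J. Math. Phys. 11 (1970) 790 (switching lemma).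
-/

noncomputable section

open Finset MeasureTheory
open scoped symmDiff ENNReal

namespace Literature.Probability.LatticeModels

variable {V : Type*} [DecidableEq V]

section Core

variable {G : SimpleGraph V} [G.LocallyFinite] {Λ : Finset V}

local notation "Eg" => edgesIn (ghostGraph G Λ) (Finset.insertNone Λ)
local notation "Zg[" θ ", " X "]" =>
  gcurrentZ (ghostGraph G Λ) (Finset.insertNone Λ) θ (edgesIn (ghostGraph G Λ) (Finset.insertNone Λ)) X
local notation "Conn[" m ", " u ", " v "]" =>
  CConn (ghostGraph G Λ) (Finset.insertNone Λ) m (edgesIn (ghostGraph G Λ) (Finset.insertNone Λ)) u v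
local notation "∂g" => csources (ghostGraph G Λ) (Finset.insertNone Λ)

/-! ### Pair sums of currents on the ghost graph with prescribed sources -/

variable (G Λ) in
/-- The pair sum `∑_{∂n₁ = X, ∂n₂ = Y} w(n₁) w(n₂) F(n₁ + n₂)` over pairs of currents on the edges of
the ghost graph inside `Λ ∪ {g}` (Duminil-Copin–Tassion 2016, §2.3–2.4: the sums
`∑_{∂n₁ = A, ∂n₂ = B} F(n₁+n₂) w(n₁)w(n₂)` of the switching lemma and of the proof of Lemma 2.6). [cite: DuminilCopinTassionCMP2016, Lemma 2.5 and proof of Lemma 2.6 (arXiv:1502.03050 numbering)] -/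
def currentPairSum (θ : Sym2 (Option V) → ℝ) (X Y : Finset (Option V))
    (F : (edgesIn (ghostGraph G Λ) (Finset.insertNone Λ) → ℕ) → ℝ≥0∞) : ℝ≥0∞ :=
  ∑' p : (edgesIn (ghostGraph G Λ) (Finset.insertNone Λ) → ℕ) ×
      (edgesIn (ghostGraph G Λ) (Finset.insertNone Λ) → ℕ),
    ind (csources (ghostGraph G Λ) (Finset.insertNone Λ) p.1 = X ∧
        CSupp (ghostGraph G Λ) (Finset.insertNone Λ) (edgesIn (ghostGraph G Λ) (Finset.insertNone Λ)) p.1) *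
      ind (csources (ghostGraph G Λ) (Finset.insertNone Λ) p.2 = Y ∧
        CSupp (ghostGraph G Λ) (Finset.insertNone Λ) (edgesIn (ghostGraph G Λ) (Finset.insertNone Λ)) p.2) *
        (gweight (ghostGraph G Λ) (Finset.insertNone Λ) θ p.1 *
          gweight (ghostGraph G Λ) (Finset.insertNone Λ) θ p.2 * F (p.1 + p.2))

/-- The pair sum with `F = 1` is the product of the two generating sums: `Z(X) Z(Y)`. [folklore] -/
theorem currentPairSum_one (θ : Sym2 (Option V) → ℝ) (X Y : Finset (Option V)) :
    currentPairSum G Λ θ X Y (fun _ => 1) =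
      gcurrentZ (ghostGraph G Λ) (Finset.insertNone Λ) θ (edgesIn (ghostGraph G Λ) (Finset.insertNone Λ)) X *
        gcurrentZ (ghostGraph G Λ) (Finset.insertNone Λ) θ (edgesIn (ghostGraph G Λ) (Finset.insertNone Λ)) Y := by
  unfold currentPairSum gcurrentZ
  rw [tsum_mul_tsum_eq_tsum_prod]
  exact tsum_congr fun p => by ring

/-- Monotonicity of the pair sum in `F` on the prescribed sources. [folklore] -/
theorem currentPairSum_mono {θ : Sym2 (Option V) → ℝ} {X Y : Finset (Option V)}
    {F F' : (edgesIn (ghostGraph G Λ) (Finset.insertNone Λ) → ℕ) → ℝ≥0∞}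
    (h : ∀ n₁ n₂, csources (ghostGraph G Λ) (Finset.insertNone Λ) n₁ = X →
      csources (ghostGraph G Λ) (Finset.insertNone Λ) n₂ = Y → F (n₁ + n₂) ≤ F' (n₁ + n₂)) :
    currentPairSum G Λ θ X Y F ≤ currentPairSum G Λ θ X Y F' := by
  unfold currentPairSum
  refine ENNReal.tsum_le_tsum fun p => ?_
  by_cases h1 : csources (ghostGraph G Λ) (Finset.insertNone Λ) p.1 = X
  · by_cases h2 : csources (ghostGraph G Λ) (Finset.insertNone Λ) p.2 = Y
    · have := h p.1 p.2 h1 h2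
      gcongr
    · rw [ind_of_false (show ¬(csources (ghostGraph G Λ) (Finset.insertNone Λ) p.2 = Y ∧ _) from
        fun h' => h2 h'.1), mul_zero, zero_mul, zero_mul]
  · rw [ind_of_false (show ¬(csources (ghostGraph G Λ) (Finset.insertNone Λ) p.1 = X ∧ _) from
      fun h' => h1 h'.1), zero_mul, zero_mul, zero_mul]

/-- The pair sum only depends on `F` on the prescribed sources. [folklore] -/
theorem currentPairSum_congr {θ : Sym2 (Option V) → ℝ} {X Y : Finset (Option V)}
    {F F' : (edgesIn (ghostGraph G Λ) (Finset.insertNone Λ) → ℕ) → ℝ≥0∞}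
    (h : ∀ n₁ n₂, csources (ghostGraph G Λ) (Finset.insertNone Λ) n₁ = X →
      csources (ghostGraph G Λ) (Finset.insertNone Λ) n₂ = Y → F (n₁ + n₂) = F' (n₁ + n₂)) :
    currentPairSum G Λ θ X Y F = currentPairSum G Λ θ X Y F' :=
  le_antisymm (currentPairSum_mono fun n₁ n₂ h1 h2 => (h n₁ n₂ h1 h2).le)
    (currentPairSum_mono fun n₁ n₂ h1 h2 => (h n₁ n₂ h1 h2).ge)

/-- Additivity of the pair sum in `F`. [folklore] -/
theorem currentPairSum_add (θ : Sym2 (Option V) → ℝ) (X Y : Finset (Option V))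
    (F F' : (edgesIn (ghostGraph G Λ) (Finset.insertNone Λ) → ℕ) → ℝ≥0∞) :
    currentPairSum G Λ θ X Y (fun m => F m + F' m) = currentPairSum G Λ θ X Y F + currentPairSum G Λ θ X Y F' := by
  unfold currentPairSum
  rw [← ENNReal.tsum_add]
  exact tsum_congr fun p => by ring

/-- The pair sum of a finite sum of functions. [folklore] -/
theorem currentPairSum_finset_sum {ι : Type*} (θ : Sym2 (Option V) → ℝ) (X Y : Finset (Option V))
    (s : Finset ι) (F : ι → (edgesIn (ghostGraph G Λ) (Finset.insertNone Λ) → ℕ) → ℝ≥0∞) :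
    currentPairSum G Λ θ X Y (fun m => ∑ i ∈ s, F i m) = ∑ i ∈ s, currentPairSum G Λ θ X Y (F i) := by
  classical
  induction s using Finset.induction_on with
  | empty =>
    simp only [sum_empty]
    unfold currentPairSum
    simp
  | insert i s hi ih =>
    simp only [sum_insert hi]
    rw [currentPairSum_add, ih]

/-- Scaling the function scales the pair sum. [folklore] -/
theorem currentPairSum_mul_left (θ : Sym2 (Option V) → ℝ) (X Y : Finset (Option V)) (c : ℝ≥0∞)
    (F : (edgesIn (ghostGraph G Λ) (Finset.insertNone Λ) → ℕ) → ℝ≥0∞) :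
    currentPairSum G Λ θ X Y (fun m => c * F m) = c * currentPairSum G Λ θ X Y F := by
  unfold currentPairSum
  rw [← ENNReal.tsum_mul_left]
  exact tsum_congr fun p => by ring

/-- The pair sum is bounded by `Z(X) Z(Y)` when `F ≤ 1`. [folklore] -/
theorem currentPairSum_le_of_le_one {θ : Sym2 (Option V) → ℝ} {X Y : Finset (Option V)}
    {F : (edgesIn (ghostGraph G Λ) (Finset.insertNone Λ) → ℕ) → ℝ≥0∞} (hF : ∀ m, F m ≤ 1) :
    currentPairSum G Λ θ X Y F ≤
      gcurrentZ (ghostGraph G Λ) (Finset.insertNone Λ) θ (edgesIn (ghostGraph G Λ) (Finset.insertNone Λ)) X *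
        gcurrentZ (ghostGraph G Λ) (Finset.insertNone Λ) θ (edgesIn (ghostGraph G Λ) (Finset.insertNone Λ)) Y := by
  rw [← currentPairSum_one]
  exact currentPairSum_mono fun n₁ n₂ _ _ => hF _

/-- **The switching lemma for pair sums** (Duminil-Copin–Tassion 2016, Lemma 2.5):
`currentPairSum (A ∆ {u,v}) {u,v} F = currentPairSum A ∅ (F · 𝟙[u ⟷ v])`. [cite: DuminilCopinTassionCMP2016, Lemma 2.5 (switching lemma) (arXiv:1502.03050 numbering)] -/
theorem currentPairSum_switching {θ : Sym2 (Option V) → ℝ} (hθ : ∀ e, 0 ≤ θ e) (A : Finset (Option V))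
    (u v : Option V) (F : (edgesIn (ghostGraph G Λ) (Finset.insertNone Λ) → ℕ) → ℝ≥0∞) :
    currentPairSum G Λ θ (A ∆ ({u} ∆ {v})) ({u} ∆ {v}) F =
      currentPairSum G Λ θ A ∅ (fun m => F m *
        ind (CConn (ghostGraph G Λ) (Finset.insertNone Λ) m (edgesIn (ghostGraph G Λ) (Finset.insertNone Λ)) u v)) :=
  tsum_switching_theta (ghostGraph G Λ) (Finset.insertNone Λ) hθ _ A u v F

/-! ### The source sets -/

omit [DecidableEq V] in
/-- `#(A ∆ B) + 2 #(A ∩ B) = #A + #B`. [folklore] -/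
theorem card_symmDiff_add_two_mul {α : Type*} [DecidableEq α] (A B : Finset α) :
    #(A ∆ B) + 2 * #(A ∩ B) = #A + #B := by
  rw [Finset.symmDiff_def, card_union_of_disjoint disjoint_sdiff_sdiff]
  have h1 := card_sdiff_add_card_inter A B
  have h2 := card_sdiff_add_card_inter B A
  rw [inter_comm B A] at h2
  omega

omit [DecidableEq V] in
/-- Parity of a symmetric difference: `#(A ∆ B)` is even iff `#A` and `#B` have the same parity. [folklore] -/
theorem even_card_symmDiff_iff {α : Type*} [DecidableEq α] (A B : Finset α) :
    Even #(A ∆ B) ↔ (Even #A ↔ Even #B) := by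
  have h := card_symmDiff_add_two_mul A B
  have h' : Even #(A ∆ B) ↔ Even (#(A ∆ B) + 2 * #(A ∩ B)) := by
    rw [Nat.even_add]
    exact (iff_true_right ⟨#(A ∩ B), by ring⟩).symm
  rw [h', h, Nat.even_add]

omit [DecidableEq V] in
/-- `#({a} ∆ {b})` is even (`0` or `2`). [folklore] -/
theorem even_card_singleton_symmDiff {α : Type*} [DecidableEq α] (a b : α) :
    Even #(({a} : Finset α) ∆ {b}) := by
  by_cases h : a = b
  · subst h; simp
  · have hd : Disjoint ({a} : Finset α) {b} := by simpa using h
    rw [hd.symmDiff_eq_sup, sup_eq_union, ← insert_eq, card_pair h]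
    exact ⟨1, rfl⟩

/-- `({o} ∆ {x})* = {o*} ∆ ... `: the lifted pair source set. [folklore] -/
theorem starSet_pair (o x : V) :
    starSet ({o} ∆ {x}) = ({some o} ∆ {some x} : Finset (Option V)) := by
  rw [starSet_of_even (even_card_singleton_symmDiff o x), map_eq_image, image_symmDiff _ _ Function.Embedding.some.injective,
    image_singleton, image_singleton]
  rfl

/-- `{o}* = {o, g}`: `starSet {o} = {some o} ∆ {none}`. [folklore] -/
theorem starSet_singleton (o : V) : starSet ({o} : Finset V) = ({some o} ∆ {none} : Finset (Option V)) := by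
  rw [starSet, if_neg (by simp)]
  ext (_ | a) <;> simp [Finset.mem_insertNone, mem_symmDiff]

/-- The odd source set of the three-spin observable: `insertNone ({o} ∆ ({x} ∆ {y}))` is
`({o} ∆ {x})* ∆ ({y}* )`, i.e. `(({some o} ∆ {some x}) ∆ ({some y} ∆ {none}))`. [folklore] -/
theorem insertNone_triple (o x y : V) :
    Finset.insertNone ({o} ∆ ({x} ∆ {y})) =
      ((({some o} ∆ {some x}) ∆ ({some y} ∆ {none})) : Finset (Option V)) := by
  ext (_ | a)
  · simp [Finset.mem_insertNone, mem_symmDiff]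
  · simp only [Finset.some_mem_insertNone, mem_symmDiff, mem_singleton, Option.some.injEq,
      reduceCtorEq]
    tauto

/-- The odd source set in switching form: `insertNone ({o} ∆ ({x} ∆ {y})) = ({x,y})* ∆ ({o}* )`
with `({x} ∆ {y})* = {some x} ∆ {some y}` and `{o}* = {some o} ∆ {none}`. [folklore] -/
theorem insertNone_triple' (o x y : V) :
    Finset.insertNone ({o} ∆ ({x} ∆ {y})) =
      ((({some x} ∆ {some y}) ∆ ({some o} ∆ {none})) : Finset (Option V)) := by
  rw [insertNone_triple]
  ext v
  simp only [mem_symmDiff, mem_singleton]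
  tauto

/-! ### The three-spin covariance as a double current with `o ↮ g` (eq. (2.11)–(2.12)) -/

/-- `Z(({x} ∆ {y})*) · Z({o}*) = ∑_{∂n₁ = (oxy)*, ∂n₂ = ∅} w w 𝟙[o ⟷ g]` (switching lemma with
`{u, v} = {o, g}`; Duminil-Copin–Tassion 2016, proof of Lemma 2.6, "Using (2.2) and the switching
lemma, we obtain" (2.11)). [cite: DuminilCopinTassionCMP2016, proof of Lemma 2.6, derivation of eq. (2.11) (arXiv:1502.03050 numbering)] -/
theorem gcurrentZ_pair_mul_single {θ : Sym2 (Option V) → ℝ} (hθ : ∀ e, 0 ≤ θ e) (o x y : V) :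
    Zg[θ, starSet ({x} ∆ {y})] * Zg[θ, starSet {o}] =
      currentPairSum G Λ θ (Finset.insertNone ({o} ∆ ({x} ∆ {y}))) ∅ (fun m => ind Conn[m, some o, none]) := by
  rw [← currentPairSum_one, starSet_pair, starSet_singleton, insertNone_triple']
  conv_lhs => rw [show ({some x} ∆ {some y} : Finset (Option V)) =
    (({some x} ∆ {some y}) ∆ ({some o} ∆ {none})) ∆ ({some o} ∆ {none}) from
    (symmDiff_symmDiff_cancel_right _ _).symm]
  rw [currentPairSum_switching hθ]
  exact currentPairSum_congr fun _ _ _ _ => by rw [one_mul]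

/-- `Z((oxy)*) · Z(∅) = ∑_{∂n₁ = (oxy)*, ∂n₂ = ∅} w w (𝟙[o ⟷ g] + 𝟙[o ↮ g])`. [folklore] -/
theorem gcurrentZ_triple_mul_empty (θ : Sym2 (Option V) → ℝ) (o x y : V) :
    Zg[θ, Finset.insertNone ({o} ∆ ({x} ∆ {y}))] * Zg[θ, ∅] =
      currentPairSum G Λ θ (Finset.insertNone ({o} ∆ ({x} ∆ {y}))) ∅ (fun m => ind Conn[m, some o, none]) +
        currentPairSum G Λ θ (Finset.insertNone ({o} ∆ ({x} ∆ {y}))) ∅ (fun m => ind (¬Conn[m, some o, none])) := by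
  rw [← currentPairSum_one, ← currentPairSum_add]
  refine currentPairSum_congr fun n₁ n₂ _ _ => ?_
  by_cases h : Conn[n₁ + n₂, some o, none]
  · rw [ind_of_true h, ind_of_false (not_not.2 h), add_zero]
  · rw [ind_of_false h, ind_of_true h, zero_add]

/-- **The three-spin covariance as a double current** (Duminil-Copin–Tassion 2016, eq. (2.11)):
for `o, x, y ∈ Λ`, `β ≥ 0`, `h ≥ 0`,
`⟨σ_oσ_xσ_y⟩ - ⟨σ_o⟩⟨σ_xσ_y⟩ = Z⁻² ∑_{∂n₁ = {o,g} ∆ {x,y}, ∂n₂ = ∅} w(n₁)w(n₂) 𝟙[o ↮ g]`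
(here `σ_xσ_y = σ_{{x} ∆ {y}}` and `σ_oσ_xσ_y = σ_{{o} ∆ {x} ∆ {y}}`, finite-volume free state with
field `h` in the tree's parametrisation, couplings `β` and `βh` on the ghost graph). [cite: DuminilCopinTassionCMP2016, proof of Lemma 2.6, eq. (2.11) (arXiv:1502.03050 numbering)] -/
theorem isingCorr_triple_sub_eq {β h : ℝ} (hβ : 0 ≤ β) (hh : 0 ≤ h) {o x y : V} (ho : o ∈ Λ)
    (hx : x ∈ Λ) (hy : y ∈ Λ) :
    isingCorr G Λ β h .free ({o} ∆ ({x} ∆ {y})) -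
        isingCorr G Λ β h .free {o} * isingCorr G Λ β h .free ({x} ∆ {y}) =
      (currentPairSum G Λ (ghostCoupling β (β * h)) (Finset.insertNone ({o} ∆ ({x} ∆ {y}))) ∅
          (fun m => ind (¬Conn[m, some o, none]))).toReal /
        (Zg[ghostCoupling β (β * h), ∅]).toReal ^ 2 := by
  have hxy : ({x} ∆ {y} : Finset V) ⊆ Λ :=
    symmDiff_le_sup.trans (sup_le (singleton_subset_iff.2 hx) (singleton_subset_iff.2 hy))
  have hoxy : ({o} ∆ ({x} ∆ {y}) : Finset V) ⊆ Λ :=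
    symmDiff_le_sup.trans (sup_le (singleton_subset_iff.2 ho) hxy)
  have hstar : starSet ({o} ∆ ({x} ∆ {y})) = Finset.insertNone ({o} ∆ ({x} ∆ {y})) := by
    have heven : Even #(Finset.insertNone ({o} ∆ ({x} ∆ {y}))) := by
      rw [insertNone_triple', even_card_symmDiff_iff]
      exact iff_of_true (even_card_singleton_symmDiff _ _) (even_card_singleton_symmDiff _ _)
    rw [← (eraseNone_eq_iff_eq_starSet heven _).1 (Finset.eraseNone_insertNone _)]
  rw [isingCorr_free_eq_gcurrentZ_div subset_rfl hβ hh hoxy,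
    isingCorr_free_eq_gcurrentZ_div subset_rfl hβ hh (singleton_subset_iff.2 ho),
    isingCorr_free_eq_gcurrentZ_div subset_rfl hβ hh hxy, hstar]
  set θ : Sym2 (Option V) → ℝ := ghostCoupling β (β * h) with hθdef
  have hθ : ∀ e, 0 ≤ θ e := fun e => by rw [hθdef]; exact ghostCoupling_nonneg hβ (mul_nonneg hβ hh) e
  set Z := Zg[θ, ∅] with hZ
  have hZpos : 0 < Z.toReal := toReal_gcurrentZ_ghost_empty_pos subset_rfl hθ subset_rfl
  have hfin : ∀ X, Zg[θ, X] ≠ ∞ := fun X => gcurrentZ_ne_top hθ subset_rfl X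
  -- the two product identities, in `ℝ`
  have h1 := congrArg ENNReal.toReal (gcurrentZ_triple_mul_empty (G := G) (Λ := Λ) θ o x y)
  have h2 := congrArg ENNReal.toReal (gcurrentZ_pair_mul_single (G := G) (Λ := Λ) hθ o x y)
  have hP1 : currentPairSum G Λ θ (Finset.insertNone ({o} ∆ ({x} ∆ {y}))) ∅ (fun m => ind Conn[m, some o, none]) ≠ ∞ :=
    ne_top_of_le_ne_top (ENNReal.mul_ne_top (hfin _) (hfin _))
      (currentPairSum_le_of_le_one fun m => ind_le_one _)
  have hP2 : currentPairSum G Λ θ (Finset.insertNone ({o} ∆ ({x} ∆ {y}))) ∅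
      (fun m => ind (¬Conn[m, some o, none])) ≠ ∞ :=
    ne_top_of_le_ne_top (ENNReal.mul_ne_top (hfin _) (hfin _))
      (currentPairSum_le_of_le_one fun m => ind_le_one _)
  rw [ENNReal.toReal_mul, ENNReal.toReal_add hP1 hP2] at h1
  rw [ENNReal.toReal_mul] at h2
  field_simp
  linear_combination h1 - h2

/-! ### Exactly one of `x`, `y` lies in the cluster of `o` (the "pivotal edge" picture) -/

omit [DecidableEq V] [G.LocallyFinite] in
/-- Filtering `insertNone T` by a predicate failing at the ghost. [folklore] -/
theorem card_filter_insertNone_of_not {T : Finset V} {p : Option V → Prop} [DecidablePred p]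
    (hp : ¬p none) : #((Finset.insertNone T).filter p) = #(T.filter fun t => p (some t)) := by
  have : (Finset.insertNone T).filter p = (T.filter fun t => p (some t)).map Function.Embedding.some := by
    ext (_ | a)
    · simp [Finset.mem_insertNone, hp]
    · simp
  rw [this, card_map]

omit [G.LocallyFinite] in
/-- Parity count on the triple `{o} ∆ ({x} ∆ {y})` (`x ≠ y`) for a predicate holding at `o`: the
number of its elements satisfying `q` is even iff exactly one of `q x`, `q y` holds. [folklore] -/
theorem even_card_filter_triple_iff {o x y : V} (hxy : x ≠ y) {q : V → Prop} [DecidablePred q]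
    (hqo : q o) : Even #((({o} ∆ ({x} ∆ {y})) : Finset V).filter q) ↔ (q x ↔ ¬q y) := by
  by_cases hox : o = x
  · subst hox
    rw [symmDiff_symmDiff_cancel_left, filter_singleton]
    by_cases hqy : q y
    · simp [hqy, hqo]
    · simp [hqy, hqo]
  · by_cases hoy : o = y
    · subst hoy
      rw [symmDiff_comm ({x} : Finset V) {o}, symmDiff_symmDiff_cancel_left, filter_singleton]
      by_cases hqx : q x
      · simp [hqx, hqo]
      · simp [hqx, hqo]
    · have hdxy : Disjoint ({x} : Finset V) {y} := by simpa using hxy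
      have hset : (({o} ∆ ({x} ∆ {y})) : Finset V) = insert o (insert x {y}) := by
        rw [hdxy.symmDiff_eq_sup, sup_eq_union, ← insert_eq]
        have hd : Disjoint ({o} : Finset V) (insert x {y}) := by
          simp [hox, hoy]
        rw [hd.symmDiff_eq_sup, sup_eq_union, ← insert_eq]
      rw [hset, filter_insert, if_pos hqo]
      have hnot : o ∉ (insert x {y} : Finset V).filter q := by
        simp [hox, hoy]
      rw [card_insert_of_notMem hnot, filter_insert, filter_singleton]
      by_cases hqx : q x <;> by_cases hqy : q y <;>
        simp [hqx, hqy, hxy, Nat.even_add_one]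

/-- **Exactly one of `x, y` is connected to `o`** (Duminil-Copin–Tassion 2016, proof of Lemma 2.6:
"If `n₁` and `n₂` are two currents such that `∂n₁ = {0,g} ∆ {x,y}`, `∂n₂ = ∅` and `0` and `g` are
not connected in `n₁ + n₂`, then exactly one of these two cases holds: `0 ⟷ x` and `y ⟷ g`, or
`0 ⟷ y` and `x ⟷ g`"; here the part about `0`, proved by the parity of the sources of `n₁` in the
cluster of `0`). [cite: DuminilCopinTassionCMP2016, proof of Lemma 2.6, the display defining δ_{x,y} (arXiv:1502.03050 numbering)] -/
theorem xor_cconn_of_csources_eq {n m : Eg → ℕ} (hle : n ≤ m) {o x y : V} (hxy : x ≠ y)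
    (hA : ∂g n = Finset.insertNone ({o} ∆ ({x} ∆ {y}))) (hog : ¬Conn[m, some o, none]) :
    (Conn[m, some o, some x] ∧ ¬Conn[m, some o, some y]) ∨
      (Conn[m, some o, some y] ∧ ¬Conn[m, some o, some x]) := by
  classical
  have hev := even_card_csources_filter_cconn hle (some o)
  rw [hA] at hev
  have hev' : Even #((Finset.insertNone ({o} ∆ ({x} ∆ {y}))).filter fun v => Conn[m, some o, v]) := by
    convert hev using 2
  rw [card_filter_insertNone_of_not hog,
    even_card_filter_triple_iff hxy (q := fun t => Conn[m, some o, some t]) Relation.ReflTransGen.refl] at hev'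
  by_cases hx : Conn[m, some o, some x]
  · exact Or.inl ⟨hx, hev'.1 hx⟩
  · right
    refine ⟨?_, hx⟩
    by_contra hy
    exact hx (hev'.2 hy)

variable (G Λ) in
/-- The one-sided pivotal sum `T(x,y) = ∑_{∂n₁ = {o,g} ∆ {x,y}, ∂n₂ = ∅} w w 𝟙[o ↮ g, o ↮ y, o ⟷ x]`
(Duminil-Copin–Tassion 2016, eq. (2.12): `δ_{x,y}`, with "`y ⟷ g`" recorded as `o ↮ y`). [cite: DuminilCopinTassionCMP2016, proof of Lemma 2.6, eq. (2.12) (δ_{x,y}) (arXiv:1502.03050 numbering)] -/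
def dctDelta (θ : Sym2 (Option V) → ℝ) (o x y : V) : ℝ≥0∞ :=
  currentPairSum G Λ θ (Finset.insertNone ({o} ∆ ({x} ∆ {y}))) ∅
    (fun m => ind (¬Conn[m, some o, none] ∧ ¬Conn[m, some o, some y] ∧ Conn[m, some o, some x]))

/-- **Eq. (2.12)**: `∑_{∂n₁ = {o,g} ∆ {x,y}, ∂n₂ = ∅} w w 𝟙[o ↮ g] = δ_{x,y} + δ_{y,x}` for `x ≠ y`. [cite: DuminilCopinTassionCMP2016, proof of Lemma 2.6, eq. (2.12) (arXiv:1502.03050 numbering)] -/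
theorem currentPairSum_notConn_eq_dctDelta_add (θ : Sym2 (Option V) → ℝ) {o x y : V} (hxy : x ≠ y) :
    currentPairSum G Λ θ (Finset.insertNone ({o} ∆ ({x} ∆ {y}))) ∅ (fun m => ind (¬Conn[m, some o, none])) =
      dctDelta G Λ θ o x y + dctDelta G Λ θ o y x := by
  unfold dctDelta
  rw [symmDiff_comm ({y} : Finset V) {x}, ← currentPairSum_add]
  refine currentPairSum_congr fun n₁ n₂ h1 _ => ?_
  by_cases hog : Conn[n₁ + n₂, some o, none]
  · rw [ind_of_false (not_not.2 hog), ind_of_false (fun h => h.1 hog), ind_of_false (fun h => h.1 hog),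
      add_zero]
  · rw [ind_of_true hog]
    rcases xor_cconn_of_csources_eq (fun e => Nat.le_add_right _ _) hxy h1 hog with ⟨hx, hy⟩ | ⟨hy, hx⟩
    · rw [ind_of_true ⟨hog, hy, hx⟩, ind_of_false (fun h => h.2.1 hx), add_zero]
    · rw [ind_of_false (fun h => h.2.1 hy), ind_of_true ⟨hog, hx, hy⟩, zero_add]

/-! ### Factorisation of pair sums on the event `𝒮_b(n₁ + n₂) = S` (Claims 1 and 2) -/

local notation "Gg" => ghostGraph G Λ
local notation "Λg" => Finset.insertNone Λ

variable (G Λ) in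
/-- The `Λ⁺ ∖ S` factor of the factorised pair sum: currents inside `Λ⁺ ∖ S` with prescribed
sources, weighted by the indicator that every vertex of `Λ⁺ ∖ S` is joined to `b` inside `Λ⁺ ∖ S`. [cite: DuminilCopinTassionCMP2016, proof of Lemma 2.6, Claim 1 (arXiv:1502.03050 numbering)] -/
def outerSum (θ : Sym2 (Option V) → ℝ) (S : Finset (Option V)) (b : Option V) (X₂ Y₂ : Finset (Option V)) : ℝ≥0∞ :=
  ∑' q : (Eg → ℕ) × (Eg → ℕ),
    ind (CSupp Gg Λg (edgesIn Gg (Λg \ S)) q.1 ∧ CSupp Gg Λg (edgesIn Gg (Λg \ S)) q.2) *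
      (ind (∂g q.1 = X₂) * ind (∂g q.2 = Y₂) *
        (gweight Gg Λg θ q.1 * gweight Gg Λg θ q.2 *
          ind (∀ v ∈ Λg \ S, CConn Gg Λg (q.1 + q.2) (edgesIn Gg (Λg \ S)) b v)))

/-- The `S` factor is a product of two generating sums of currents inside `S`. [folklore] -/
theorem tsum_inner_eq_mul (θ : Sym2 (Option V) → ℝ) (S : Finset (Option V)) (X₁ Y₁ : Finset (Option V)) :
    ∑' a : (Eg → ℕ) × (Eg → ℕ),
        ind (CSupp Gg Λg (edgesIn Gg S) a.1 ∧ CSupp Gg Λg (edgesIn Gg S) a.2) *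
          (ind (∂g a.1 = X₁) * ind (∂g a.2 = Y₁) * (gweight Gg Λg θ a.1 * gweight Gg Λg θ a.2)) =
      gcurrentZ Gg Λg θ (edgesIn Gg S) X₁ * gcurrentZ Gg Λg θ (edgesIn Gg S) Y₁ := by
  unfold gcurrentZ
  rw [tsum_mul_tsum_eq_tsum_prod]
  refine tsum_congr fun a => ?_
  rw [ind_and]
  have h1 : ind (∂g a.1 = X₁ ∧ CSupp Gg Λg (edgesIn Gg S) a.1) = ind (∂g a.1 = X₁) * ind (CSupp Gg Λg (edgesIn Gg S) a.1) :=
    ind_and _ _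
  have h2 : ind (∂g a.2 = Y₁ ∧ CSupp Gg Λg (edgesIn Gg S) a.2) = ind (∂g a.2 = Y₁) * ind (CSupp Gg Λg (edgesIn Gg S) a.2) :=
    ind_and _ _
  rw [h1, h2]
  ring

/-- **Factorisation of a pair sum on `{𝒮_b(n₁+n₂) = S}`** (Duminil-Copin–Tassion 2016, proof of
Lemma 2.6, Claims 1 and 2: decompose `nᵢ = nᵢ^S + nᵢ^{Λ∖S}`, `w(nᵢ) = w(nᵢ^S) w(nᵢ^{Λ∖S})`,
"`𝟙[𝒮 = S]` does not depend on `n₁^S`"): for `S ⊆ Λ ∪ {g}` and `b ∈ (Λ ∪ {g}) ∖ S`,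
`∑_{∂n₁ = X, ∂n₂ = Y} w w 𝟙[𝒮_b = S] = Z_S(X ∩ S) Z_S(Y ∩ S) · Ψ_S(X ∖ S, Y ∖ S)` where `Z_S` sums
over currents on the edges inside `S` and `Ψ_S` (`outerSum`) over pairs of currents inside the
complement connecting all of it to `b`. [cite: DuminilCopinTassionCMP2016, proof of Lemma 2.6, Claims 1–2 (arXiv:1502.03050 numbering)] -/
theorem currentPairSum_clusterCompl_eq (θ : Sym2 (Option V) → ℝ) {S : Finset (Option V)} (hS : S ⊆ Λg)
    {b : Option V} (hb : b ∈ Λg \ S) (X Y : Finset (Option V)) :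
    currentPairSum G Λ θ X Y (fun m => ind (clusterCompl Gg Λg m b = S)) =
      gcurrentZ Gg Λg θ (edgesIn Gg S) (X.filter (· ∈ S)) * gcurrentZ Gg Λg θ (edgesIn Gg S) (Y.filter (· ∈ S)) *
        outerSum G Λ θ S b (X.filter (· ∉ S)) (Y.filter (· ∉ S)) := by
  set E₁ := edgesIn Gg S with hE₁
  set E₂ := edgesIn Gg (Λg \ S) with hE₂
  have hdisj : Disjoint E₁ E₂ := disjoint_edgesIn_sdiff S
  -- pointwise rewriting of the summand
  set G₁ : (Eg → ℕ) → (Eg → ℕ) → ℝ≥0∞ := fun a₁ a₂ =>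
    ind (∂g a₁ = X.filter (· ∈ S)) * ind (∂g a₂ = Y.filter (· ∈ S)) * (gweight Gg Λg θ a₁ * gweight Gg Λg θ a₂)
    with hG₁
  set G₂ : (Eg → ℕ) → (Eg → ℕ) → ℝ≥0∞ := fun b₁ b₂ =>
    ind (∂g b₁ = X.filter (· ∉ S)) * ind (∂g b₂ = Y.filter (· ∉ S)) *
      (gweight Gg Λg θ b₁ * gweight Gg Λg θ b₂ * ind (∀ v ∈ Λg \ S, CConn Gg Λg (b₁ + b₂) E₂ b v))
    with hG₂
  have hpt : ∀ p : (Eg → ℕ) × (Eg → ℕ),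
      ind (∂g p.1 = X ∧ CSupp Gg Λg Eg p.1) * ind (∂g p.2 = Y ∧ CSupp Gg Λg Eg p.2) *
          (gweight Gg Λg θ p.1 * gweight Gg Λg θ p.2 * ind (clusterCompl Gg Λg (p.1 + p.2) b = S)) =
        ind (CSupp Gg Λg (E₁ ∪ E₂) p.1) * ind (CSupp Gg Λg (E₁ ∪ E₂) p.2) *
          (G₁ (crestr Gg Λg E₁ p.1) (crestr Gg Λg E₁ p.2) * G₂ (crestr Gg Λg E₂ p.1) (crestr Gg Λg E₂ p.2)) := by
    intro p
    by_cases hcut : CSupp Gg Λg (E₁ ∪ E₂) p.1 ∧ CSupp Gg Λg (E₁ ∪ E₂) p.2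
    · obtain ⟨hc1, hc2⟩ := hcut
      have hc12 : CSupp Gg Λg (E₁ ∪ E₂) (p.1 + p.2) := (csupp_add_iff p.1 p.2).2 ⟨hc1, hc2⟩
      rw [ind_of_true hc1, ind_of_true hc2, one_mul, one_mul]
      -- sources
      have hsrc : ∀ (n : Eg → ℕ) (Z : Finset (Option V)), CSupp Gg Λg (E₁ ∪ E₂) n →
          (ind (∂g n = Z ∧ CSupp Gg Λg Eg n) =
            ind (∂g (crestr Gg Λg E₁ n) = Z.filter (· ∈ S)) * ind (∂g (crestr Gg Λg E₂ n) = Z.filter (· ∉ S))) := by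
        intro n Z hn
        rw [← ind_and]
        refine ind_congr ?_
        rw [csources_crestr_inner hn, csources_crestr_outer hn]
        constructor
        · rintro ⟨h, -⟩
          rw [h]
          exact ⟨rfl, rfl⟩
        · rintro ⟨h1, h2⟩
          refine ⟨?_, csupp_edgesIn n⟩
          rw [← filter_union_filter_not_eq (· ∈ S) (∂g n), ← filter_union_filter_not_eq (· ∈ S) Z, h1, h2]
      -- weights
      have hw1 := gweight_eq_mul_of_csupp_union θ hdisj hc1
      have hw2 := gweight_eq_mul_of_csupp_union θ hdisj hc2
      -- the event
      have hev : ind (clusterCompl Gg Λg (p.1 + p.2) b = S) =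
          ind (∀ v ∈ Λg \ S, CConn Gg Λg (crestr Gg Λg E₂ p.1 + crestr Gg Λg E₂ p.2) E₂ b v) := by
        refine ind_congr ?_
        rw [clusterCompl_eq_iff hS hb, ← crestr_add]
        simp only [cconn_crestr_iff]
        exact ⟨fun h => h.2, fun h => ⟨hc12, h⟩⟩
      rw [hsrc p.1 X hc1, hsrc p.2 Y hc2, hw1, hw2, hev]
      simp only [hG₁, hG₂]
      ring
    · -- the event forces the cut condition
      have hzero : ind (clusterCompl Gg Λg (p.1 + p.2) b = S) = 0 ∨
          (CSupp Gg Λg (E₁ ∪ E₂) p.1 ∧ CSupp Gg Λg (E₁ ∪ E₂) p.2) := by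
        by_cases hS' : clusterCompl Gg Λg (p.1 + p.2) b = S
        · exact Or.inr ((csupp_add_iff p.1 p.2).1 (csupp_cut_of_clusterCompl_eq hS'))
        · exact Or.inl (ind_of_false hS')
      rcases hzero with h0 | h
      · rw [h0, mul_zero, mul_zero]
        rcases not_and_or.1 hcut with h1 | h2
        · rw [ind_of_false h1, zero_mul, zero_mul]
        · rw [ind_of_false h2, mul_zero, zero_mul]
      · exact absurd h hcut
  unfold currentPairSum
  simp_rw [hpt]
  rw [tsum_pair_eq_mul_of_csupp_union Gg Λg hdisj G₁ G₂, tsum_inner_eq_mul]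
  rfl

/-- `∑_{S ∈ T} 𝟙[c = S] = 𝟙[c ∈ T]`. [folklore] -/
theorem sum_ind_eq_eq_ind_mem {α : Type*} [DecidableEq α] (T : Finset α) (c : α) :
    ∑ S ∈ T, ind (c = S) = ind (c ∈ T) := by
  by_cases hc : c ∈ T
  · rw [sum_eq_single c (fun S _ hS => ind_of_false fun h => hS h.symm) (fun h => absurd hc h),
      ind_of_true rfl, ind_of_true hc]
  · rw [ind_of_false hc]
    exact sum_eq_zero fun S hS => ind_of_false fun h => hc (h ▸ hS)

/-! ### Claim 1 -/

/-- Membership of the ghost in `𝒮_o`. [folklore] -/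
theorem none_mem_clusterCompl_iff {m : Eg → ℕ} {o : V} :
    (none : Option V) ∈ clusterCompl Gg Λg m (some o) ↔ ¬Conn[m, some o, none] := by
  rw [mem_clusterCompl]
  exact ⟨fun h => h.2, fun h => ⟨Finset.mem_insertNone.2 (by simp), h⟩⟩

/-- Membership of a real vertex of `Λ` in `𝒮_b`. [folklore] -/
theorem some_mem_clusterCompl_iff {m : Eg → ℕ} {b : Option V} {v : V} (hv : v ∈ Λ) :
    (some v : Option V) ∈ clusterCompl Gg Λg m b ↔ ¬CConn Gg Λg m Eg b (some v) := by
  rw [mem_clusterCompl]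
  exact ⟨fun h => h.2, fun h => ⟨Finset.some_mem_insertNone.2 hv, h⟩⟩

/-- The side conditions on `S` in Claim 1: `g, y ∈ S`, `o, x ∉ S`. [cite: DuminilCopinTassionCMP2016, proof of Lemma 2.6, eq. (2.13) and Claim 1 (arXiv:1502.03050 numbering)] -/
def Claim1Side (o x y : V) (S : Finset (Option V)) : Prop :=
  (none : Option V) ∈ S ∧ (some y : Option V) ∈ S ∧ (some o : Option V) ∉ S ∧ (some x : Option V) ∉ S

omit [G.LocallyFinite] in
/-- Decidability of the side conditions. [folklore] -/
instance Claim1Side.decidable (o x y : V) (S : Finset (Option V)) : Decidable (Claim1Side o x y S) := by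
  unfold Claim1Side; infer_instance

/-- The side conditions hold for `𝒮_o(m)` iff `o ↮ g`, `o ↮ y` and `o ⟷ x`. [folklore] -/
theorem claim1Side_clusterCompl_iff {m : Eg → ℕ} {o x y : V} (hx : x ∈ Λ) (hy : y ∈ Λ) :
    Claim1Side o x y (clusterCompl Gg Λg m (some o)) ↔
      ¬Conn[m, some o, none] ∧ ¬Conn[m, some o, some y] ∧ Conn[m, some o, some x] := by
  unfold Claim1Side
  rw [none_mem_clusterCompl_iff, some_mem_clusterCompl_iff hy, some_mem_clusterCompl_iff hx, not_not]
  have := not_mem_clusterCompl_self (G := Gg) (Λ := Λg) m (some o)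
  tauto

/-- **Decomposition of `δ_{x,y}` over the values of `𝒮_o`** (Duminil-Copin–Tassion 2016,
eq. (2.13): "Let us compute `δ_{x,y}` by summing over the different possible values for `𝒮_0`"). [cite: DuminilCopinTassionCMP2016, proof of Lemma 2.6, eq. (2.13) (arXiv:1502.03050 numbering)] -/
theorem dctDelta_eq_sum (θ : Sym2 (Option V) → ℝ) {o x y : V} (hx : x ∈ Λ) (hy : y ∈ Λ) :
    dctDelta G Λ θ o x y =
      ∑ S ∈ (Λg).powerset.filter (Claim1Side o x y),
        currentPairSum G Λ θ (Finset.insertNone ({o} ∆ ({x} ∆ {y}))) ∅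
          (fun m => ind (clusterCompl Gg Λg m (some o) = S)) := by
  unfold dctDelta
  rw [← currentPairSum_finset_sum]
  refine currentPairSum_congr fun n₁ n₂ _ _ => ?_
  rw [sum_ind_eq_eq_ind_mem, mem_filter, ← claim1Side_clusterCompl_iff hx hy]
  refine ind_congr ⟨fun h => ⟨mem_powerset.2 (clusterCompl_subset _ _), h⟩, fun h => h.2⟩

/-- Under the side conditions, the sources of `A* = insertNone ({o} ∆ ({x} ∆ {y}))` inside `S`
are `{y, g} = {y}*`. [folklore] -/
theorem filter_mem_insertNone_triple {o x y : V} (hxy : x ≠ y) {S : Finset (Option V)}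
    (hS : Claim1Side o x y S) :
    (Finset.insertNone ({o} ∆ ({x} ∆ {y}))).filter (· ∈ S) = starSet {y} := by
  obtain ⟨hn, hyS, hoS, hxS⟩ := hS
  have hyo : y ≠ o := fun h => hoS (h ▸ hyS)
  rw [starSet_singleton]
  ext (_ | t)
  · simp [Finset.mem_insertNone, mem_symmDiff, hn]
  · simp only [mem_filter, Finset.some_mem_insertNone, mem_symmDiff, mem_singleton, Option.some.injEq,
      reduceCtorEq]
    constructor
    · rintro ⟨_, htS⟩
      have hto : t ≠ o := fun h => hoS (h ▸ htS)
      have htx : t ≠ x := fun h => hxS (h ▸ htS)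
      tauto
    · rintro h
      have ht : t = y := by tauto
      subst ht
      refine ⟨?_, hyS⟩
      tauto

/-- Under the side conditions, the sources of `A*` outside `S` are `{o} ∆ {x}` (lifted). [folklore] -/
theorem filter_not_mem_insertNone_triple {o x y : V} (hxy : x ≠ y) {S : Finset (Option V)}
    (hS : Claim1Side o x y S) :
    (Finset.insertNone ({o} ∆ ({x} ∆ {y}))).filter (· ∉ S) = starSet ({o} ∆ {x}) := by
  obtain ⟨hn, hyS, hoS, hxS⟩ := hS
  have hyo : y ≠ o := fun h => hoS (h ▸ hyS)
  rw [starSet_pair]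
  ext (_ | t)
  · simp [Finset.mem_insertNone, mem_symmDiff, hn]
  · simp only [mem_filter, Finset.some_mem_insertNone, mem_symmDiff, mem_singleton, Option.some.injEq]
    constructor
    · rintro ⟨ht, htS⟩
      have hty : t ≠ y := fun h => htS (h ▸ hyS)
      tauto
    · rintro h
      have ht : t = o ∨ t = x := by tauto
      rcases ht with rfl | rfl
      · refine ⟨?_, hoS⟩; tauto
      · refine ⟨?_, hxS⟩; tauto

/-- Under the side conditions, `{y}* ⊆ S`. [folklore] -/
theorem filter_mem_starSet_singleton {o x y : V} {S : Finset (Option V)} (hS : Claim1Side o x y S) :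
    (starSet ({y} : Finset V)).filter (· ∈ S) = starSet {y} ∧ (starSet ({y} : Finset V)).filter (· ∉ S) = ∅ := by
  obtain ⟨hn, hyS, -, -⟩ := hS
  have hsub : ∀ v ∈ starSet ({y} : Finset V), v ∈ S := by
    intro v hv
    rw [starSet_singleton, mem_symmDiff, mem_singleton, mem_singleton] at hv
    rcases hv with ⟨rfl, -⟩ | ⟨rfl, -⟩
    · exact hyS
    · exact hn
  exact ⟨filter_true_of_mem hsub, filter_false_of_mem fun v hv => not_not.2 (hsub v hv)⟩

/-- **The Griffiths step of Claim 1 in current form**: for `S ∋ g` inside `Λ ∪ {g}` and `y` with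
`some y ∈ S`, `Z_S({y}*) · Z_Λ(∅) ≤ Z_Λ({y}*) · Z_S(∅)`, i.e. `⟨σ_y⟩_{S∖{g},β,h} ≤ ⟨σ_y⟩_{Λ,β,h}`
((2.2) in `S ∖ {g}` and in `Λ`, and Griffiths' monotonicity in the volume with field;
Duminil-Copin–Tassion 2016, proof of Claim 1: "Multiply … by `⟨σ_y⟩_{Λ,β,h} ≥ ⟨σ_y⟩_{S,β,h}`
(which follows from (2.4))"). [cite: DuminilCopinTassionCMP2016, proof of Lemma 2.6, Claim 1, and eq. (2.4) (arXiv:1502.03050 numbering)] -/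
theorem gcurrentZ_cross_le {β h : ℝ} (hβ : 0 ≤ β) (hh : 0 ≤ h) {S : Finset (Option V)} (hS : S ⊆ Λg)
    (hn : (none : Option V) ∈ S) {y : V} (hy : (some y : Option V) ∈ S) :
    gcurrentZ Gg Λg (ghostCoupling β (β * h)) (edgesIn Gg S) (starSet {y}) * Zg[ghostCoupling β (β * h), ∅] ≤
      Zg[ghostCoupling β (β * h), starSet {y}] * gcurrentZ Gg Λg (ghostCoupling β (β * h)) (edgesIn Gg S) ∅ := by
  set θ : Sym2 (Option V) → ℝ := ghostCoupling β (β * h) with hθdef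
  have hθ : ∀ e : Sym2 (Option V), 0 ≤ θ e := ghostCoupling_nonneg hβ (mul_nonneg hβ hh)
  -- `S = (S ∖ {g}) ∪ {g}`
  set Sr : Finset V := Finset.eraseNone S with hSr
  have hSeq : S = Finset.insertNone Sr := by
    rw [hSr, Finset.insertNone_eraseNone, insert_eq_of_mem hn]
  have hSrΛ : Sr ⊆ Λ := fun t ht => Finset.some_mem_insertNone.1 (hS (Finset.mem_eraseNone.1 ht))
  have hySr : y ∈ Sr := Finset.mem_eraseNone.2 hy
  have hyΛ : y ∈ Λ := hSrΛ hySr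
  rw [hSeq]
  -- the two representations and the comparison of volumes
  have hS' := isingCorr_free_eq_gcurrentZ_div (G := G) (Λ := Λ) hSrΛ hβ hh (singleton_subset_iff.2 hySr)
  have hΛ' := isingCorr_free_eq_gcurrentZ_div (G := G) (Λ := Λ) subset_rfl hβ hh (singleton_subset_iff.2 hyΛ)
  have hmono : isingCorr G Sr β h .free {y} ≤ isingCorr G Λ β h .free {y} :=
    Literature.Probability.LatticeModels.isingCorr_free_mono_volume_of_gks G (fun G' _ _ _ _ _ _ _ => GKSInequalities.gks_two_holds G') hβ hh
      (singleton_subset_iff.2 hySr) hSrΛ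
  rw [hS', hΛ'] at hmono
  have hpS := toReal_gcurrentZ_ghost_empty_pos (G := G) (Λ := Λ) hSrΛ hθ subset_rfl
  have hpΛ := toReal_gcurrentZ_ghost_empty_pos (G := G) (Λ := Λ) (subset_rfl (a := Λ)) hθ subset_rfl
  rw [div_le_div_iff₀ hpS hpΛ] at hmono
  have hfinS : ∀ X, gcurrentZ Gg Λg θ (edgesIn Gg (Finset.insertNone Sr)) X ≠ ∞ := fun X =>
    gcurrentZ_ne_top hθ (edgesIn_insertNone_mono hSrΛ) X
  have hfinΛ : ∀ X, Zg[θ, X] ≠ ∞ := fun X => gcurrentZ_ne_top hθ subset_rfl X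
  rw [← ENNReal.toReal_le_toReal (ENNReal.mul_ne_top (hfinS _) (hfinΛ _))
    (ENNReal.mul_ne_top (hfinΛ _) (hfinS _)), ENNReal.toReal_mul, ENNReal.toReal_mul]
  exact hmono

/-- **Claim 1 for a fixed `S`** (Duminil-Copin–Tassion 2016, proof of Lemma 2.6, Claim 1): under the
side conditions `g, y ∈ S`, `o, x ∉ S` (`S ⊆ Λ ∪ {g}`),
`Z_Λ(∅) ∑_{∂n₁ = {o}∆{x}, ∂n₂ = ∅} w w 𝟙[𝒮_o = S, y ⟷ g] ≤ Z_Λ({y}*) ∑_{∂n₁ = A*, ∂n₂ = ∅} w w 𝟙[𝒮_o = S]`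
(factorise both sides on the cut, compare `⟨σ_y⟩_S ≤ ⟨σ_y⟩_Λ`, and switch the sources `{y, g}`). [cite: DuminilCopinTassionCMP2016, proof of Lemma 2.6, Claim 1 (arXiv:1502.03050 numbering)] -/
theorem claim1_fixed {β h : ℝ} (hβ : 0 ≤ β) (hh : 0 ≤ h) {o x y : V} (ho : o ∈ Λ) (hxy : x ≠ y)
    {S : Finset (Option V)} (hSΛ : S ⊆ Λg) (hS : Claim1Side o x y S) :
    Zg[ghostCoupling β (β * h), ∅] *
        currentPairSum G Λ (ghostCoupling β (β * h)) (starSet ({o} ∆ {x})) ∅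
          (fun m => ind (clusterCompl Gg Λg m (some o) = S) * ind Conn[m, some y, none]) ≤
      Zg[ghostCoupling β (β * h), starSet {y}] *
        currentPairSum G Λ (ghostCoupling β (β * h)) (Finset.insertNone ({o} ∆ ({x} ∆ {y}))) ∅
          (fun m => ind (clusterCompl Gg Λg m (some o) = S)) := by
  set θ : Sym2 (Option V) → ℝ := ghostCoupling β (β * h) with hθdef
  have hθ : ∀ e : Sym2 (Option V), 0 ≤ θ e := ghostCoupling_nonneg hβ (mul_nonneg hβ hh)
  have hb : (some o : Option V) ∈ Λg \ S := mem_sdiff.2 ⟨Finset.some_mem_insertNone.2 ho, hS.2.2.1⟩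
  -- switch the right-hand side with sources `{y, g}` moved to `n₂`
  have hsw : currentPairSum G Λ θ (starSet ({o} ∆ {x})) ∅
        (fun m => ind (clusterCompl Gg Λg m (some o) = S) * ind Conn[m, some y, none]) =
      currentPairSum G Λ θ (Finset.insertNone ({o} ∆ ({x} ∆ {y}))) (starSet {y})
        (fun m => ind (clusterCompl Gg Λg m (some o) = S)) := by
    rw [insertNone_triple, starSet_singleton, ← starSet_pair, currentPairSum_switching hθ]
  rw [hsw, currentPairSum_clusterCompl_eq θ hSΛ hb, currentPairSum_clusterCompl_eq θ hSΛ hb,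
    filter_mem_insertNone_triple hxy hS, filter_not_mem_insertNone_triple hxy hS,
    (filter_mem_starSet_singleton hS).1, (filter_mem_starSet_singleton hS).2]
  simp only [filter_empty]
  have hcross := gcurrentZ_cross_le (G := G) (Λ := Λ) hβ hh hSΛ hS.1 hS.2.1
  calc Zg[θ, ∅] * (gcurrentZ Gg Λg θ (edgesIn Gg S) (starSet {y}) * gcurrentZ Gg Λg θ (edgesIn Gg S) (starSet {y}) *
        outerSum G Λ θ S (some o) (starSet ({o} ∆ {x})) ∅)
      = (gcurrentZ Gg Λg θ (edgesIn Gg S) (starSet {y}) * Zg[θ, ∅]) *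
          (gcurrentZ Gg Λg θ (edgesIn Gg S) (starSet {y}) * outerSum G Λ θ S (some o) (starSet ({o} ∆ {x})) ∅) := by
        ring
    _ ≤ (Zg[θ, starSet {y}] * gcurrentZ Gg Λg θ (edgesIn Gg S) ∅) *
          (gcurrentZ Gg Λg θ (edgesIn Gg S) (starSet {y}) * outerSum G Λ θ S (some o) (starSet ({o} ∆ {x})) ∅) :=
        mul_le_mul' hcross le_rfl
    _ = _ := by ring

/-- **Claim 1, summed** (Duminil-Copin–Tassion 2016, proof of Lemma 2.6, the display after Claim 1:
"Inserting (Claim 1) into (2.13) gives us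
`δ_{x,y} ≥ ⟨σ_y⟩⁻¹ ∑_{∂n₁ = {0}∆{x}, ∂n₂ = ∅} w w 𝟙[y ⟷ g, 0 ↮ g]`"), in the multiplicative form
`Z(∅) · ∑_{∂n₁ = ({o}∆{x})*, ∂n₂ = ∅} w w 𝟙[o ↮ g, y ⟷ g] ≤ Z({y}*) · δ_{x,y}`. [cite: DuminilCopinTassionCMP2016, proof of Lemma 2.6, Claim 1 and the following display (arXiv:1502.03050 numbering)] -/
theorem claim1 {β h : ℝ} (hβ : 0 ≤ β) (hh : 0 ≤ h) {o x y : V} (ho : o ∈ Λ) (hx : x ∈ Λ) (hy : y ∈ Λ)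
    (hxy : x ≠ y) :
    Zg[ghostCoupling β (β * h), ∅] *
        currentPairSum G Λ (ghostCoupling β (β * h)) (starSet ({o} ∆ {x})) ∅
          (fun m => ind (¬Conn[m, some o, none] ∧ Conn[m, some y, none])) ≤
      Zg[ghostCoupling β (β * h), starSet {y}] * dctDelta G Λ (ghostCoupling β (β * h)) o x y := by
  set θ : Sym2 (Option V) → ℝ := ghostCoupling β (β * h) with hθdef
  set T := (Λg).powerset.filter (Claim1Side o x y) with hT
  -- lower bound the left-hand side by the sum over `S` of the switched terms
  have hL : currentPairSum G Λ θ (starSet ({o} ∆ {x})) ∅ (fun m => ind (¬Conn[m, some o, none] ∧ Conn[m, some y, none])) ≤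
      ∑ S ∈ T, currentPairSum G Λ θ (starSet ({o} ∆ {x})) ∅
        (fun m => ind (clusterCompl Gg Λg m (some o) = S) * ind Conn[m, some y, none]) := by
    rw [← currentPairSum_finset_sum]
    refine currentPairSum_mono fun n₁ n₂ h1 _ => ?_
    rw [← sum_mul, sum_ind_eq_eq_ind_mem, ← ind_and]
    refine ind_mono fun ⟨hog, hyg⟩ => ⟨?_, hyg⟩
    rw [hT, mem_filter, claim1Side_clusterCompl_iff hx hy]
    refine ⟨mem_powerset.2 (clusterCompl_subset _ _), hog, fun hoy => hog (hoy.trans hyg), ?_⟩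
    -- `o ⟷ x` from the sources of `n₁`
    by_cases hox : o = x
    · subst hox; exact Relation.ReflTransGen.refl
    · have hsrc : ∂g n₁ = ({some o} ∆ {some x} : Finset (Option V)) := by rw [h1, starSet_pair]
      exact ((cconn_of_csources_eq (fun h => hox (Option.some_injective _ h)) hsrc).mono
        fun e => Nat.le_add_right _ _)
  calc Zg[θ, ∅] * currentPairSum G Λ θ (starSet ({o} ∆ {x})) ∅ (fun m => ind (¬Conn[m, some o, none] ∧ Conn[m, some y, none]))
      ≤ Zg[θ, ∅] * ∑ S ∈ T, currentPairSum G Λ θ (starSet ({o} ∆ {x})) ∅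
          (fun m => ind (clusterCompl Gg Λg m (some o) = S) * ind Conn[m, some y, none]) :=
        mul_le_mul' le_rfl hL
    _ = ∑ S ∈ T, Zg[θ, ∅] * currentPairSum G Λ θ (starSet ({o} ∆ {x})) ∅
          (fun m => ind (clusterCompl Gg Λg m (some o) = S) * ind Conn[m, some y, none]) := mul_sum _ _ _
    _ ≤ ∑ S ∈ T, Zg[θ, starSet {y}] * currentPairSum G Λ θ (Finset.insertNone ({o} ∆ ({x} ∆ {y}))) ∅
          (fun m => ind (clusterCompl Gg Λg m (some o) = S)) :=
        sum_le_sum fun S hS => claim1_fixed hβ hh ho hxy (mem_powerset.1 (mem_filter.1 hS).1) (mem_filter.1 hS).2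
    _ = Zg[θ, starSet {y}] * dctDelta G Λ θ o x y := by
        rw [← mul_sum, ← dctDelta_eq_sum θ hx hy]

/-! ### Claim 2: the event `𝒮_g = S'` and the zero-field state in `S'` -/

/-- The edges of the ghost graph inside a set of real vertices are the lifted edges of `G`. [folklore] -/
theorem edgesIn_ghostGraph_map_some (S' : Finset V) :
    edgesIn Gg (S'.map Function.Embedding.some) = (edgesIn G S').map liftEdge := by
  ext e
  rw [mem_edgesIn_iff, mem_map]
  induction e using Sym2.ind with
  | _ a b =>
    constructor
    · rintro ⟨hadj, hmem⟩
      have ha := hmem a (Sym2.mem_mk_left a b)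
      have hb := hmem b (Sym2.mem_mk_right a b)
      rw [mem_map] at ha hb
      obtain ⟨x, hx, rfl⟩ := ha
      obtain ⟨y, hy, rfl⟩ := hb
      refine ⟨s(x, y), mem_edgesIn_iff.2 ⟨?_, fun v hv => ?_⟩, rfl⟩
      · exact (SimpleGraph.mem_edgeSet G).2 (ghostGraph_adj_some_some.1 ((SimpleGraph.mem_edgeSet _).1 hadj))
      · rcases Sym2.mem_iff.1 hv with rfl | rfl
        · exact hx
        · exact hy
    · rintro ⟨e, he, hexy⟩
      induction e using Sym2.ind with
      | _ x y =>
        rw [liftEdge_mk] at hexy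
        obtain ⟨hadj, hmem⟩ := mem_edgesIn_iff.1 he
        rw [← hexy]
        refine ⟨(SimpleGraph.mem_edgeSet _).2 (ghostGraph_adj_some_some.2 ((SimpleGraph.mem_edgeSet G).1 hadj)),
          fun v hv => ?_⟩
        rcases Sym2.mem_iff.1 hv with rfl | rfl
        · exact mem_map_of_mem _ (hmem x (Sym2.mem_mk_left x y))
        · exact mem_map_of_mem _ (hmem y (Sym2.mem_mk_right x y))

variable (G Λ) in
/-- The weight `W(S') = ∑_{∂n₁ = ∂n₂ = ∅} w(n₁)w(n₂) 𝟙[𝒮_g = S']` of the event that the set of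
vertices not connected to the ghost is `S'` (Duminil-Copin–Tassion 2016, (2.14) and Remark 2.2:
"`𝐏_β ⊗ 𝐏_β(𝒮_g = S)`", unnormalised). [cite: DuminilCopinTassionCMP2016, proof of Lemma 2.6, eq. (2.14) and Remark 2.2 (arXiv:1502.03050 numbering)] -/
def dctW (θ : Sym2 (Option V) → ℝ) (S' : Finset V) : ℝ≥0∞ :=
  currentPairSum G Λ θ ∅ ∅ (fun m => ind (clusterCompl Gg Λg m none = S'.map Function.Embedding.some))

/-- **Claim 2** (Duminil-Copin–Tassion 2016, proof of Lemma 2.6: "Let `S ⊂ Λ` containing `0` and `x`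
but neither `y` nor `g`. We have
`∑_{∂n₁ = {0}∆{x}, ∂n₂ = ∅} w w 𝟙[𝒮_g = S] = ∑_{∂n₁ = ∂n₂ = ∅} w w ⟨σ₀σ_x⟩_{S,β,0} 𝟙[𝒮_g = S]`"),
in current form: `(∑_{∂n₁ = ({o}∆{x})*, ∂n₂ = ∅} w w 𝟙[𝒮_g = S']) · Z_{S'}(∅) = Z_{S'}(({o}∆{x})*) · W(S')`
with `Z_{S'}` the zero-field current sums on the edges of `G` inside `S'`. [cite: DuminilCopinTassionCMP2016, proof of Lemma 2.6, Claim 2 (arXiv:1502.03050 numbering)] -/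
theorem claim2 (θ : Sym2 (Option V) → ℝ) {S' : Finset V} (hS' : S' ⊆ Λ) {o x : V} (ho : o ∈ S')
    (hx : x ∈ S') :
    currentPairSum G Λ θ (starSet ({o} ∆ {x})) ∅
          (fun m => ind (clusterCompl Gg Λg m none = S'.map Function.Embedding.some)) *
        gcurrentZ Gg Λg θ ((edgesIn G S').map liftEdge) ∅ =
      gcurrentZ Gg Λg θ ((edgesIn G S').map liftEdge) (starSet ({o} ∆ {x})) * dctW G Λ θ S' := by
  set S := S'.map Function.Embedding.some with hSdef
  have hSΛ : S ⊆ Λg := fun v hv => by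
    obtain ⟨t, ht, rfl⟩ := mem_map.1 hv
    exact Finset.some_mem_insertNone.2 (hS' ht)
  have hb : (none : Option V) ∈ Λg \ S :=
    mem_sdiff.2 ⟨Finset.mem_insertNone.2 (by simp), fun h => by
      obtain ⟨t, -, ht⟩ := mem_map.1 h; exact Option.some_ne_none t ht⟩
  have hmem : ∀ v ∈ starSet ({o} ∆ {x}), v ∈ S := by
    intro v hv
    rw [starSet_pair, mem_symmDiff, mem_singleton, mem_singleton] at hv
    rcases hv with ⟨rfl, -⟩ | ⟨rfl, -⟩
    · exact mem_map_of_mem _ ho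
    · exact mem_map_of_mem _ hx
  have hX : (starSet ({o} ∆ {x})).filter (· ∈ S) = starSet ({o} ∆ {x}) := filter_true_of_mem hmem
  have hX' : (starSet ({o} ∆ {x})).filter (· ∉ S) = ∅ :=
    filter_false_of_mem fun v hv => not_not.2 (hmem v hv)
  unfold dctW
  rw [currentPairSum_clusterCompl_eq θ hSΛ hb, currentPairSum_clusterCompl_eq θ hSΛ hb, hX, hX',
    ← edgesIn_ghostGraph_map_some]
  simp only [filter_empty]
  ring

/-- If `o ∈ S'` but `x ∉ S'`, the event `𝒮_g = S'` is incompatible with the sources `{o} ∆ {x}`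
(the sources force `o ⟷ x`). [folklore] -/
theorem currentPairSum_clusterCompl_none_eq_zero (θ : Sym2 (Option V) → ℝ) {S' : Finset V} {o x : V}
    (ho : o ∈ S') (hxS : x ∉ S') (hxΛ : x ∈ Λ) :
    currentPairSum G Λ θ (starSet ({o} ∆ {x})) ∅
        (fun m => ind (clusterCompl Gg Λg m none = S'.map Function.Embedding.some)) = 0 := by
  have h0 : currentPairSum G Λ θ (starSet ({o} ∆ {x})) ∅ (fun _ => 0) = 0 := by
    unfold currentPairSum; simp
  rw [← h0]
  refine currentPairSum_congr fun n₁ n₂ h1 _ => ind_of_false fun hS => ?_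
  have hox : o ≠ x := fun h => hxS (h ▸ ho)
  have hsrc : ∂g n₁ = ({some o} ∆ {some x} : Finset (Option V)) := by rw [h1, starSet_pair]
  have hconn : Conn[n₁ + n₂, some o, some x] :=
    (cconn_of_csources_eq (fun h => hox (Option.some_injective _ h)) hsrc).mono fun e => Nat.le_add_right _ _
  have hoS : (some o : Option V) ∈ clusterCompl Gg Λg (n₁ + n₂) none := hS ▸ mem_map_of_mem _ ho
  have hxS' : (some x : Option V) ∉ clusterCompl Gg Λg (n₁ + n₂) none := fun h => by
    rw [hS] at h
    obtain ⟨t, ht, htx⟩ := mem_map.1 h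
    exact hxS ((Option.some_injective _ htx) ▸ ht)
  rw [some_mem_clusterCompl_iff hxΛ, not_not] at hxS'
  exact (mem_clusterCompl.1 hoS).2 (hxS'.trans hconn.symm)

/-- `𝒮_g(m)` has no ghost, so it is the lift of its real part. [folklore] -/
theorem clusterCompl_none_eq_map (m : Eg → ℕ) :
    clusterCompl Gg Λg m none = (Finset.eraseNone (clusterCompl Gg Λg m none)).map Function.Embedding.some := by
  rw [Finset.map_some_eraseNone, erase_eq_of_notMem (not_mem_clusterCompl_self m none)]

/-- The real part of `𝒮_g(m)` lies in `Λ`. [folklore] -/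
theorem eraseNone_clusterCompl_subset (m : Eg → ℕ) (b : Option V) :
    Finset.eraseNone (clusterCompl Gg Λg m b) ⊆ Λ := fun _ ht =>
  Finset.some_mem_insertNone.1 (clusterCompl_subset m b (Finset.mem_eraseNone.1 ht))

/-- Summing the indicators `𝟙[𝒮_g = S']` over the real sets `S' ⊆ Λ` with a property. [folklore] -/
theorem sum_ind_clusterCompl_none (m : Eg → ℕ) (Q : Finset V → Prop) [DecidablePred Q] :
    ∑ S' ∈ Λ.powerset.filter Q, ind (clusterCompl Gg Λg m none = S'.map Function.Embedding.some) =
      ind (Q (Finset.eraseNone (clusterCompl Gg Λg m none))) := by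
  set S₀ := Finset.eraseNone (clusterCompl Gg Λg m none) with hS₀
  have hrw : ∀ S' : Finset V, ind (clusterCompl Gg Λg m none = S'.map Function.Embedding.some) = ind (S₀ = S') := by
    intro S'
    refine ind_congr ?_
    rw [clusterCompl_none_eq_map m, ← hS₀]
    exact ⟨fun h => Finset.map_injective _ h, fun h => by rw [h]⟩
  simp_rw [hrw]
  rw [sum_ind_eq_eq_ind_mem, mem_filter]
  exact ind_congr ⟨fun h => h.2, fun h => ⟨mem_powerset.2 (eraseNone_clusterCompl_subset m none), h⟩⟩

/-- Real vertices of `Λ` in `𝒮_g(m)`: `t ∈ 𝒮_g ↔ t ↮ g`. [folklore] -/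
theorem mem_eraseNone_clusterCompl_none_iff {m : Eg → ℕ} {t : V} (ht : t ∈ Λ) :
    t ∈ Finset.eraseNone (clusterCompl Gg Λg m none) ↔ ¬Conn[m, some t, none] := by
  rw [Finset.mem_eraseNone, some_mem_clusterCompl_iff ht]
  exact ⟨fun h h' => h h'.symm, fun h h' => h h'.symm⟩

/-- **Decomposition over `𝒮_g`** (Duminil-Copin–Tassion 2016, eq. (2.13): "We now decompose over the
possible values of `𝒮_g`"): for `o, y ∈ Λ`,
`∑_{∂n₁ = ({o}∆{x})*, ∂n₂ = ∅} w w 𝟙[o ↮ g, y ⟷ g] = ∑_{S' ⊆ Λ, o ∈ S', y ∉ S'} ∑ w w 𝟙[𝒮_g = S']`. [cite: DuminilCopinTassionCMP2016, proof of Lemma 2.6, eq. (2.13) (arXiv:1502.03050 numbering)] -/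
theorem currentPairSum_notConn_conn_eq_sum (θ : Sym2 (Option V) → ℝ) {o y : V} (ho : o ∈ Λ) (hy : y ∈ Λ) (x : V) :
    currentPairSum G Λ θ (starSet ({o} ∆ {x})) ∅ (fun m => ind (¬Conn[m, some o, none] ∧ Conn[m, some y, none])) =
      ∑ S' ∈ Λ.powerset.filter (fun S' => o ∈ S' ∧ y ∉ S'),
        currentPairSum G Λ θ (starSet ({o} ∆ {x})) ∅
          (fun m => ind (clusterCompl Gg Λg m none = S'.map Function.Embedding.some)) := by
  rw [← currentPairSum_finset_sum]
  refine currentPairSum_congr fun n₁ n₂ _ _ => ?_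
  rw [sum_ind_clusterCompl_none, mem_eraseNone_clusterCompl_none_iff ho,
    mem_eraseNone_clusterCompl_none_iff hy, not_not]

/-- `∑_{S' ∋ o} W(S') = ∑_{∂n₁ = ∂n₂ = ∅} w w 𝟙[o ↮ g]`. [folklore] -/
theorem sum_dctW_eq (θ : Sym2 (Option V) → ℝ) {o : V} (ho : o ∈ Λ) :
    ∑ S' ∈ Λ.powerset.filter (fun S' => o ∈ S'), dctW G Λ θ S' =
      currentPairSum G Λ θ ∅ ∅ (fun m => ind (¬Conn[m, some o, none])) := by
  unfold dctW
  rw [← currentPairSum_finset_sum]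
  refine currentPairSum_congr fun n₁ n₂ _ _ => ?_
  rw [sum_ind_clusterCompl_none, mem_eraseNone_clusterCompl_none_iff ho]

/-- `Z(∅)² = ∑_{∅,∅} w w 𝟙[o ⟷ g] + ∑_{∅,∅} w w 𝟙[o ↮ g]` and `∑_{∅,∅} w w 𝟙[o ⟷ g] = Z({o}*)²`
(switching): `Z(∅)·Z(∅) = Z({o}*)·Z({o}*) + ∑_{S' ∋ o} W(S')`. [cite: DuminilCopinTassionCMP2016, proof of Lemma 2.6, last display ("Using (2.3) and (2.2) one more time") (arXiv:1502.03050 numbering)] -/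
theorem gcurrentZ_empty_sq_eq {θ : Sym2 (Option V) → ℝ} (hθ : ∀ e, 0 ≤ θ e) {o : V} (ho : o ∈ Λ) :
    Zg[θ, ∅] * Zg[θ, ∅] =
      Zg[θ, starSet {o}] * Zg[θ, starSet {o}] + ∑ S' ∈ Λ.powerset.filter (fun S' => o ∈ S'), dctW G Λ θ S' := by
  rw [sum_dctW_eq θ ho, ← currentPairSum_one, ← currentPairSum_one, starSet_singleton]
  have hsw : currentPairSum G Λ θ ({some o} ∆ {none}) ({some o} ∆ {none}) (fun _ => 1) =
      currentPairSum G Λ θ ∅ ∅ (fun m => ind Conn[m, some o, none]) := by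
    have h0 : (∅ : Finset (Option V)) ∆ ({some o} ∆ {none}) = {some o} ∆ {none} := bot_symmDiff _
    have h1 := currentPairSum_switching (G := G) (Λ := Λ) hθ ∅ (some o) none (fun _ => 1)
    rw [h0] at h1
    rw [h1]
    exact currentPairSum_congr fun _ _ _ _ => by rw [one_mul]
  rw [hsw, ← currentPairSum_add]
  refine currentPairSum_congr fun n₁ n₂ _ _ => ?_
  by_cases hc : Conn[n₁ + n₂, some o, none]
  · rw [ind_of_true hc, ind_of_false (not_not.2 hc), add_zero]
  · rw [ind_of_false hc, ind_of_true hc, zero_add]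

/-! ### The truncated two-point function as a double current with `o ↮ g` -/

/-- `Z({o}*) Z({x}*) = ∑_{∂n₁ = ({o}∆{x})*, ∂n₂ = ∅} w w 𝟙[o ⟷ g]` (switching with `{u,v} = {x,g}`,
then `x ⟷ g ⟺ o ⟷ g` on `∂n₁ = {o} ∆ {x}`). [cite: DuminilCopinTassionCMP2016, Lemma 2.5 and eq. (2.2) (arXiv:1502.03050 numbering)] -/
theorem gcurrentZ_single_mul_single {θ : Sym2 (Option V) → ℝ} (hθ : ∀ e, 0 ≤ θ e) (o x : V) :
    Zg[θ, starSet {o}] * Zg[θ, starSet {x}] =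
      currentPairSum G Λ θ (starSet ({o} ∆ {x})) ∅ (fun m => ind Conn[m, some o, none]) := by
  rw [← currentPairSum_one, starSet_singleton, starSet_singleton, starSet_pair]
  have h0 : (({some o} ∆ {some x}) ∆ ({some x} ∆ {none}) : Finset (Option V)) = {some o} ∆ {none} := by
    rw [symmDiff_assoc, symmDiff_symmDiff_cancel_left]
  have h1 := currentPairSum_switching (G := G) (Λ := Λ) hθ ({some o} ∆ {some x}) (some x) none (fun _ => 1)
  rw [h0] at h1
  rw [h1]
  refine currentPairSum_congr fun n₁ n₂ hs _ => ?_
  rw [one_mul]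
  refine ind_congr ?_
  by_cases hox : o = x
  · subst hox; rfl
  · have hconn : Conn[n₁ + n₂, some o, some x] :=
      (cconn_of_csources_eq (fun h => hox (Option.some_injective _ h)) hs).mono fun e => Nat.le_add_right _ _
    exact ⟨fun h => hconn.trans h, fun h => hconn.symm.trans h⟩

/-- `Z(({o}∆{x})*) Z(∅) = ∑_{({o}∆{x})*, ∅} w w 𝟙[o ⟷ g] + ∑_{({o}∆{x})*, ∅} w w 𝟙[o ↮ g]`. [folklore] -/
theorem gcurrentZ_pair_mul_empty (θ : Sym2 (Option V) → ℝ) (o x : V) :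
    Zg[θ, starSet ({o} ∆ {x})] * Zg[θ, ∅] =
      currentPairSum G Λ θ (starSet ({o} ∆ {x})) ∅ (fun m => ind Conn[m, some o, none]) +
        currentPairSum G Λ θ (starSet ({o} ∆ {x})) ∅ (fun m => ind (¬Conn[m, some o, none])) := by
  rw [← currentPairSum_one, ← currentPairSum_add]
  refine currentPairSum_congr fun n₁ n₂ _ _ => ?_
  by_cases h : Conn[n₁ + n₂, some o, none]
  · rw [ind_of_true h, ind_of_false (not_not.2 h), add_zero]
  · rw [ind_of_false h, ind_of_true h, zero_add]

/-! ### Passage to real numbers -/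

/-- Pair sums with `F ≤ 1` are finite. [folklore] -/
theorem currentPairSum_ne_top {θ : Sym2 (Option V) → ℝ} (hθ : ∀ e, 0 ≤ θ e) (X Y : Finset (Option V))
    {F : (Eg → ℕ) → ℝ≥0∞} (hF : ∀ m, F m ≤ 1) : currentPairSum G Λ θ X Y F ≠ ∞ :=
  ne_top_of_le_ne_top (ENNReal.mul_ne_top (gcurrentZ_ne_top hθ subset_rfl X) (gcurrentZ_ne_top hθ subset_rfl Y))
    (currentPairSum_le_of_le_one hF)

/-- `W(S')` is finite. [folklore] -/
theorem dctW_ne_top {θ : Sym2 (Option V) → ℝ} (hθ : ∀ e, 0 ≤ θ e) (S' : Finset V) : dctW G Λ θ S' ≠ ∞ :=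
  currentPairSum_ne_top hθ ∅ ∅ fun _ => ind_le_one _

/-- `δ_{x,y}` is finite. [folklore] -/
theorem dctDelta_ne_top {θ : Sym2 (Option V) → ℝ} (hθ : ∀ e, 0 ≤ θ e) (o x y : V) : dctDelta G Λ θ o x y ≠ ∞ :=
  currentPairSum_ne_top hθ _ _ fun _ => ind_le_one _

/-- **The truncated two-point function with field as a double current**:
`⟨σ_oσ_x⟩ - ⟨σ_o⟩⟨σ_x⟩ = Z⁻² ∑_{∂n₁ = ({o}∆{x})*, ∂n₂ = ∅} w w 𝟙[o ↮ g]` (`σ_oσ_x = σ_{{o}∆{x}}`). [cite: DuminilCopinTassionCMP2016, §2.3, eq. (2.2) and Lemma 2.5 (arXiv:1502.03050 numbering)] -/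
theorem isingCorr_pair_sub_eq {β h : ℝ} (hβ : 0 ≤ β) (hh : 0 ≤ h) {o x : V} (ho : o ∈ Λ) (hx : x ∈ Λ) :
    isingCorr G Λ β h .free ({o} ∆ {x}) - isingCorr G Λ β h .free {o} * isingCorr G Λ β h .free {x} =
      (currentPairSum G Λ (ghostCoupling β (β * h)) (starSet ({o} ∆ {x})) ∅
          (fun m => ind (¬Conn[m, some o, none]))).toReal /
        (Zg[ghostCoupling β (β * h), ∅]).toReal ^ 2 := by
  have hox : ({o} ∆ {x} : Finset V) ⊆ Λ :=
    symmDiff_le_sup.trans (sup_le (singleton_subset_iff.2 ho) (singleton_subset_iff.2 hx))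
  rw [isingCorr_free_eq_gcurrentZ_div subset_rfl hβ hh hox,
    isingCorr_free_eq_gcurrentZ_div subset_rfl hβ hh (singleton_subset_iff.2 ho),
    isingCorr_free_eq_gcurrentZ_div subset_rfl hβ hh (singleton_subset_iff.2 hx)]
  set θ : Sym2 (Option V) → ℝ := ghostCoupling β (β * h) with hθdef
  have hθ : ∀ e : Sym2 (Option V), 0 ≤ θ e := ghostCoupling_nonneg hβ (mul_nonneg hβ hh)
  set Z := Zg[θ, ∅] with hZ
  have hZpos : 0 < Z.toReal := toReal_gcurrentZ_ghost_empty_pos subset_rfl hθ subset_rfl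
  have h1 := congrArg ENNReal.toReal (gcurrentZ_pair_mul_empty (G := G) (Λ := Λ) θ o x)
  have h2 := congrArg ENNReal.toReal (gcurrentZ_single_mul_single (G := G) (Λ := Λ) hθ o x)
  rw [ENNReal.toReal_mul, ENNReal.toReal_add (currentPairSum_ne_top hθ _ _ fun _ => ind_le_one _)
    (currentPairSum_ne_top hθ _ _ fun _ => ind_le_one _)] at h1
  rw [ENNReal.toReal_mul] at h2
  field_simp
  linear_combination h1 - h2

/-- **`Z⁻² ∑_{S' ∋ o} W(S') = 1 - ⟨σ_o⟩²`** (Duminil-Copin–Tassion 2016, end of the proof of Lemma 2.6: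
"Using (2.3) and (2.2) one more time, we finally obtain …`(1 - ⟨σ₀⟩²_{Λ,β,h})`"). [cite: DuminilCopinTassionCMP2016, proof of Lemma 2.6, last display (arXiv:1502.03050 numbering)] -/
theorem sum_dctW_toReal_eq {β h : ℝ} (hβ : 0 ≤ β) (hh : 0 ≤ h) {o : V} (ho : o ∈ Λ) :
    (∑ S' ∈ Λ.powerset.filter (fun S' => o ∈ S'), (dctW G Λ (ghostCoupling β (β * h)) S').toReal) /
        (Zg[ghostCoupling β (β * h), ∅]).toReal ^ 2 =
      1 - isingCorr G Λ β h .free {o} ^ 2 := by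
  rw [isingCorr_free_eq_gcurrentZ_div subset_rfl hβ hh (singleton_subset_iff.2 ho)]
  set θ : Sym2 (Option V) → ℝ := ghostCoupling β (β * h) with hθdef
  have hθ : ∀ e : Sym2 (Option V), 0 ≤ θ e := ghostCoupling_nonneg hβ (mul_nonneg hβ hh)
  have hZpos : 0 < (Zg[θ, ∅]).toReal := toReal_gcurrentZ_ghost_empty_pos subset_rfl hθ subset_rfl
  have h1 := congrArg ENNReal.toReal (gcurrentZ_empty_sq_eq (G := G) (Λ := Λ) hθ ho)
  rw [ENNReal.toReal_mul, ENNReal.toReal_add (ENNReal.mul_ne_top (gcurrentZ_ne_top hθ subset_rfl _)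
    (gcurrentZ_ne_top hθ subset_rfl _)) (ENNReal.sum_ne_top.2 fun S' _ => dctW_ne_top hθ S'),
    ENNReal.toReal_mul, ENNReal.toReal_sum (fun S' _ => dctW_ne_top hθ S')] at h1
  field_simp
  linear_combination -h1

/-- **Claim 2 in real numbers**: for `S' ⊆ Λ` with `o, x ∈ S'` and `β ≥ 0`,
`∑_{({o}∆{x})*, ∅} w w 𝟙[𝒮_g = S'] = ⟨σ_oσ_x⟩_{S',β,0} · W(S')`. [cite: DuminilCopinTassionCMP2016, proof of Lemma 2.6, Claim 2 (arXiv:1502.03050 numbering)] -/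
theorem claim2_toReal {β h : ℝ} (hβ : 0 ≤ β) (hh : 0 ≤ h) {S' : Finset V} (hS' : S' ⊆ Λ) {o x : V}
    (ho : o ∈ S') (hx : x ∈ S') :
    (currentPairSum G Λ (ghostCoupling β (β * h)) (starSet ({o} ∆ {x})) ∅
        (fun m => ind (clusterCompl Gg Λg m none = S'.map Function.Embedding.some))).toReal =
      isingCorr G S' β 0 .free ({o} ∆ {x}) * (dctW G Λ (ghostCoupling β (β * h)) S').toReal := by
  have hox : ({o} ∆ {x} : Finset V) ⊆ S' :=
    symmDiff_le_sup.trans (sup_le (singleton_subset_iff.2 ho) (singleton_subset_iff.2 hx))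
  rw [isingCorr_free_zero_eq_gcurrentZ_div (G := G) (Λ := Λ) hS' hβ (β * h) hox (even_card_singleton_symmDiff o x),
    ← starSet_of_even (even_card_singleton_symmDiff o x)]
  set θ : Sym2 (Option V) → ℝ := ghostCoupling β (β * h) with hθdef
  have hθ : ∀ e : Sym2 (Option V), 0 ≤ θ e := ghostCoupling_nonneg hβ (mul_nonneg hβ hh)
  have h1 := congrArg ENNReal.toReal (claim2 (G := G) (Λ := Λ) θ hS' ho hx)
  have hE : (edgesIn G S').map liftEdge ⊆ Eg :=
    (map_liftEdge_subset_edgesIn hS').trans (edgesIn_insertNone_mono hS')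
  have hfin : ∀ X, gcurrentZ Gg Λg θ ((edgesIn G S').map liftEdge) X ≠ ∞ := fun X => gcurrentZ_ne_top hθ hE X
  have hpos : 0 < (gcurrentZ Gg Λg θ ((edgesIn G S').map liftEdge) ∅).toReal :=
    ENNReal.toReal_pos (ne_of_gt (lt_of_lt_of_le zero_lt_one (one_le_gcurrentZ_empty θ _))) (hfin ∅)
  rw [ENNReal.toReal_mul, ENNReal.toReal_mul] at h1
  field_simp
  linear_combination h1

/-- **The correcting-term identity** (Claim 2 summed over `S' ∋ o`, then the truncated two-point
representation): for `o, x ∈ Λ`,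
`Z⁻² ∑_{S' ∋ o, x} ⟨σ_oσ_x⟩_{S',β,0} W(S') = ⟨σ_oσ_x⟩_{Λ,β,h} - ⟨σ_o⟩_{Λ,β,h}⟨σ_x⟩_{Λ,β,h}`
(this is how the boundary term of the 2018 Correction becomes `ε(Λ,β,h)`: "One then sums on every
possible value of `S` and uses the switching lemma to obtain `ε(Λ,β,h)`"). [cite: DuminilCopinTassionCMP2016, Correction CMP 359 (2018) 821, and proof of Lemma 2.6, Claim 2 (arXiv:1502.03050 numbering)] -/
theorem sum_isingCorr_zero_mul_dctW_eq {β h : ℝ} (hβ : 0 ≤ β) (hh : 0 ≤ h) {o x : V} (ho : o ∈ Λ)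
    (hx : x ∈ Λ) :
    (∑ S' ∈ Λ.powerset.filter (fun S' => o ∈ S' ∧ x ∈ S'),
        isingCorr G S' β 0 .free ({o} ∆ {x}) * (dctW G Λ (ghostCoupling β (β * h)) S').toReal) /
        (Zg[ghostCoupling β (β * h), ∅]).toReal ^ 2 =
      isingCorr G Λ β h .free ({o} ∆ {x}) - isingCorr G Λ β h .free {o} * isingCorr G Λ β h .free {x} := by
  rw [isingCorr_pair_sub_eq hβ hh ho hx]
  congr 1
  set θ : Sym2 (Option V) → ℝ := ghostCoupling β (β * h) with hθdef
  have hθ : ∀ e : Sym2 (Option V), 0 ≤ θ e := ghostCoupling_nonneg hβ (mul_nonneg hβ hh)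
  -- Claim 2 termwise
  have hterm : ∀ S' ∈ Λ.powerset.filter (fun S' => o ∈ S' ∧ x ∈ S'),
      isingCorr G S' β 0 .free ({o} ∆ {x}) * (dctW G Λ θ S').toReal =
        (currentPairSum G Λ θ (starSet ({o} ∆ {x})) ∅
          (fun m => ind (clusterCompl Gg Λg m none = S'.map Function.Embedding.some))).toReal := by
    intro S' hS'
    rw [mem_filter, mem_powerset] at hS'
    rw [claim2_toReal hβ hh hS'.1 hS'.2.1 hS'.2.2]
  rw [sum_congr rfl hterm, ← ENNReal.toReal_sum (fun S' _ => currentPairSum_ne_top hθ _ _ fun _ => ind_le_one _)]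
  congr 1
  -- add the vanishing terms `x ∉ S'` and resum over `𝒮_g`
  have hsplit : ∑ S' ∈ Λ.powerset.filter (fun S' => o ∈ S'),
      currentPairSum G Λ θ (starSet ({o} ∆ {x})) ∅ (fun m => ind (clusterCompl Gg Λg m none = S'.map Function.Embedding.some)) =
      ∑ S' ∈ Λ.powerset.filter (fun S' => o ∈ S' ∧ x ∈ S'),
        currentPairSum G Λ θ (starSet ({o} ∆ {x})) ∅ (fun m => ind (clusterCompl Gg Λg m none = S'.map Function.Embedding.some)) := by
    rw [← sum_filter_add_sum_filter_not (Λ.powerset.filter (fun S' => o ∈ S')) (fun S' => x ∈ S')]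
    have hzero : ∑ S' ∈ (Λ.powerset.filter (fun S' => o ∈ S')).filter (fun S' => x ∉ S'),
        currentPairSum G Λ θ (starSet ({o} ∆ {x})) ∅
          (fun m => ind (clusterCompl Gg Λg m none = S'.map Function.Embedding.some)) = 0 :=
      sum_eq_zero fun S' hS' => by
        rw [mem_filter, mem_filter] at hS'
        exact currentPairSum_clusterCompl_none_eq_zero θ hS'.1.2 hS'.2 hx
    rw [hzero, add_zero, filter_filter]
  rw [← hsplit, ← currentPairSum_finset_sum]
  refine currentPairSum_congr fun n₁ n₂ _ _ => ?_
  rw [sum_ind_clusterCompl_none, mem_eraseNone_clusterCompl_none_iff ho]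

/-- **Claim 1 in real numbers**: for adjacent-or-not `x ≠ y` and `o, x, y ∈ Λ`,
`Z⁻² ∑_{({o}∆{x})*, ∅} w w 𝟙[o ↮ g, y ⟷ g] ≤ ⟨σ_y⟩_{Λ,β,h} · Z⁻² δ_{x,y}`. [cite: DuminilCopinTassionCMP2016, proof of Lemma 2.6, Claim 1 and the following display (arXiv:1502.03050 numbering)] -/
theorem claim1_toReal {β h : ℝ} (hβ : 0 ≤ β) (hh : 0 ≤ h) {o x y : V} (ho : o ∈ Λ) (hx : x ∈ Λ) (hy : y ∈ Λ)
    (hxy : x ≠ y) :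
    (currentPairSum G Λ (ghostCoupling β (β * h)) (starSet ({o} ∆ {x})) ∅
          (fun m => ind (¬Conn[m, some o, none] ∧ Conn[m, some y, none]))).toReal /
        (Zg[ghostCoupling β (β * h), ∅]).toReal ^ 2 ≤
      isingCorr G Λ β h .free {y} *
        ((dctDelta G Λ (ghostCoupling β (β * h)) o x y).toReal / (Zg[ghostCoupling β (β * h), ∅]).toReal ^ 2) := by
  rw [isingCorr_free_eq_gcurrentZ_div subset_rfl hβ hh (singleton_subset_iff.2 hy)]
  set θ : Sym2 (Option V) → ℝ := ghostCoupling β (β * h) with hθdef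
  have hθ : ∀ e : Sym2 (Option V), 0 ≤ θ e := ghostCoupling_nonneg hβ (mul_nonneg hβ hh)
  have hZpos : 0 < (Zg[θ, ∅]).toReal := toReal_gcurrentZ_ghost_empty_pos subset_rfl hθ subset_rfl
  have h1 := claim1 (G := G) (Λ := Λ) hβ hh ho hx hy hxy
  rw [← ENNReal.toReal_le_toReal (ENNReal.mul_ne_top (gcurrentZ_ne_top hθ subset_rfl _)
    (currentPairSum_ne_top hθ _ _ fun _ => ind_le_one _))
    (ENNReal.mul_ne_top (gcurrentZ_ne_top hθ subset_rfl _) (dctDelta_ne_top hθ o x y)),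
    ENNReal.toReal_mul, ENNReal.toReal_mul] at h1
  rw [div_mul_div_comm, div_le_div_iff₀ (by positivity) (by positivity)]
  have hδ : 0 ≤ (dctDelta G Λ θ o x y).toReal := ENNReal.toReal_nonneg
  nlinarith [h1, hZpos, hδ]

/-- **The lower bound of Claim 1 decomposed over `𝒮_g` and evaluated by Claim 2** (real numbers):
`Z⁻² ∑_{({o}∆{x})*, ∅} w w 𝟙[o ↮ g, y ⟷ g] = ∑_{S' ⊆ Λ: o, x ∈ S', y ∉ S'} ⟨σ_oσ_x⟩_{S',β,0} · Z⁻² W(S')`. [cite: DuminilCopinTassionCMP2016, proof of Lemma 2.6, eq. (2.13) and Claim 2 (arXiv:1502.03050 numbering)] -/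
theorem currentPairSum_notConn_conn_toReal_eq {β h : ℝ} (hβ : 0 ≤ β) (hh : 0 ≤ h) {o x y : V} (ho : o ∈ Λ)
    (hx : x ∈ Λ) (hy : y ∈ Λ) :
    (currentPairSum G Λ (ghostCoupling β (β * h)) (starSet ({o} ∆ {x})) ∅
        (fun m => ind (¬Conn[m, some o, none] ∧ Conn[m, some y, none]))).toReal =
      ∑ S' ∈ Λ.powerset.filter (fun S' => o ∈ S' ∧ y ∉ S' ∧ x ∈ S'),
        isingCorr G S' β 0 .free ({o} ∆ {x}) * (dctW G Λ (ghostCoupling β (β * h)) S').toReal := by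
  set θ : Sym2 (Option V) → ℝ := ghostCoupling β (β * h) with hθdef
  have hθ : ∀ e : Sym2 (Option V), 0 ≤ θ e := ghostCoupling_nonneg hβ (mul_nonneg hβ hh)
  rw [currentPairSum_notConn_conn_eq_sum θ ho hy x,
    ENNReal.toReal_sum (fun S' _ => currentPairSum_ne_top hθ _ _ fun _ => ind_le_one _),
    ← sum_filter_add_sum_filter_not (Λ.powerset.filter (fun S' => o ∈ S' ∧ y ∉ S')) (fun S' => x ∈ S')]
  have hzero : ∑ S' ∈ (Λ.powerset.filter (fun S' => o ∈ S' ∧ y ∉ S')).filter (fun S' => x ∉ S'),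
      (currentPairSum G Λ θ (starSet ({o} ∆ {x})) ∅
        (fun m => ind (clusterCompl Gg Λg m none = S'.map Function.Embedding.some))).toReal = 0 :=
    sum_eq_zero fun S' hS' => by
      rw [mem_filter, mem_filter] at hS'
      rw [currentPairSum_clusterCompl_none_eq_zero θ hS'.1.2.1 hS'.2 hx, ENNReal.toReal_zero]
  rw [hzero, add_zero, filter_filter]
  have hset : (Λ.powerset.filter fun S' => (o ∈ S' ∧ y ∉ S') ∧ x ∈ S') =
      Λ.powerset.filter (fun S' => o ∈ S' ∧ y ∉ S' ∧ x ∈ S') :=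
    filter_congr fun S' _ => and_assoc
  rw [hset]
  refine sum_congr rfl fun S' hS' => ?_
  rw [mem_filter, mem_powerset] at hS'
  exact claim2_toReal hβ hh hS'.1 hS'.2.1 hS'.2.2.2

/-- **Eq. (2.11)–(2.12) in real numbers**: for `x ≠ y`,
`⟨σ_oσ_xσ_y⟩ - ⟨σ_o⟩⟨σ_xσ_y⟩ = Z⁻² (δ_{x,y} + δ_{y,x})`. [cite: DuminilCopinTassionCMP2016, proof of Lemma 2.6, eqs. (2.11)–(2.12) (arXiv:1502.03050 numbering)] -/
theorem isingCorr_triple_sub_eq_dctDelta {β h : ℝ} (hβ : 0 ≤ β) (hh : 0 ≤ h) {o x y : V} (ho : o ∈ Λ)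
    (hx : x ∈ Λ) (hy : y ∈ Λ) (hxy : x ≠ y) :
    isingCorr G Λ β h .free ({o} ∆ ({x} ∆ {y})) -
        isingCorr G Λ β h .free {o} * isingCorr G Λ β h .free ({x} ∆ {y}) =
      ((dctDelta G Λ (ghostCoupling β (β * h)) o x y).toReal +
          (dctDelta G Λ (ghostCoupling β (β * h)) o y x).toReal) /
        (Zg[ghostCoupling β (β * h), ∅]).toReal ^ 2 := by
  have hθ : ∀ e : Sym2 (Option V), 0 ≤ ghostCoupling β (β * h) e := ghostCoupling_nonneg hβ (mul_nonneg hβ hh)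
  rw [isingCorr_triple_sub_eq hβ hh ho hx hy, currentPairSum_notConn_eq_dctDelta_add _ hxy,
    ENNReal.toReal_add (dctDelta_ne_top hθ o x y) (dctDelta_ne_top hθ o y x)]

/-! ### Ordered adjacent pairs versus edges -/

/-- A sum over ordered pairs of adjacent vertices of `Λ` is a sum over the edges inside `Λ` of the
symmetrised summand. [folklore] -/
theorem sum_adj_eq_sum_edgesIn [DecidableRel G.Adj] (f : V → V → ℝ) :
    ∑ x ∈ Λ, ∑ y ∈ Λ.filter (G.Adj x), f x y =
      ∑ e ∈ edgesIn G Λ, Sym2.lift ⟨fun x y => f x y + f y x, fun _ _ => add_comm _ _⟩ e := by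
  set D := (Λ ×ˢ Λ).filter (fun p : V × V => G.Adj p.1 p.2) with hD
  have hL : ∑ x ∈ Λ, ∑ y ∈ Λ.filter (G.Adj x), f x y = ∑ p ∈ D, f p.1 p.2 := by
    rw [hD, sum_filter, sum_product]
    refine sum_congr rfl fun x _ => ?_
    rw [sum_filter]
  have hmaps : ∀ p ∈ D, s(p.1, p.2) ∈ edgesIn G Λ := by
    intro p hp
    rw [hD, mem_filter, mem_product] at hp
    refine mem_edgesIn_iff.2 ⟨(SimpleGraph.mem_edgeSet G).2 hp.2, fun v hv => ?_⟩
    rcases Sym2.mem_iff.1 hv with rfl | rfl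
    · exact hp.1.1
    · exact hp.1.2
  rw [hL, ← sum_fiberwise_of_maps_to hmaps]
  refine sum_congr rfl fun e he => ?_
  induction e using Sym2.ind with
  | _ x y =>
    obtain ⟨hadj, hmem⟩ := mem_edgesIn_iff.1 he
    have hadj' : G.Adj x y := (SimpleGraph.mem_edgeSet G).1 hadj
    have hxy : x ≠ y := G.ne_of_adj hadj'
    have hfib : D.filter (fun p : V × V => s(p.1, p.2) = s(x, y)) = {(x, y), (y, x)} := by
      ext p
      simp only [hD, mem_filter, mem_product, mem_insert, mem_singleton, Sym2.eq_iff]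
      constructor
      · rintro ⟨-, ⟨h1, h2⟩ | ⟨h1, h2⟩⟩
        · left; exact Prod.ext h1 h2
        · right; exact Prod.ext h1 h2
      · rintro (rfl | rfl)
        · exact ⟨⟨⟨hmem x (Sym2.mem_mk_left x y), hmem y (Sym2.mem_mk_right x y)⟩, hadj'⟩, Or.inl ⟨rfl, rfl⟩⟩
        · exact ⟨⟨⟨hmem y (Sym2.mem_mk_right x y), hmem x (Sym2.mem_mk_left x y)⟩, hadj'.symm⟩, Or.inr ⟨rfl, rfl⟩⟩
    rw [hfib, sum_pair (fun h => hxy (Prod.ext_iff.1 h).1), Sym2.lift_mk]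

/-! ### The mean-field bound for a general graph -/

/-- **The random-current core of Lemma 2.6** (Duminil-Copin–Tassion 2016, proof of Lemma 2.6,
eqs. (2.12)–(2.14) with the 2018 Correction: all sums over `y` restricted to `y ∈ Λ ∖ S`): for a
locally finite graph `G`, a finite volume `Λ ∋ o`, `β ≥ 0`, field `h ≥ 0` (tree parametrisation), and
a constant `c ≥ 0` with `c ⟨σ_y⟩_{Λ} ≤ ⟨σ_o⟩_{Λ}` for all `y ∈ Λ`,
`c · ∑_{S ∋ o} 𝐏⊗𝐏(𝒮_g = S) ∑_{x ∈ S} ∑_{y ∈ Λ∖S, y ∼ x} ⟨σ_oσ_x⟩_{S,β,0}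
   ≤ ⟨σ_o⟩_Λ · ∑_{xy ∈ ℰ_Λ} (⟨σ_oσ_xσ_y⟩_Λ - ⟨σ_o⟩_Λ⟨σ_xσ_y⟩_Λ)`,
where `𝐏⊗𝐏(𝒮_g = S) = Z⁻² W(S)`. [cite: DuminilCopinTassionCMP2016, proof of Lemma 2.6, eqs. (2.12)–(2.14), Claims 1–2 (arXiv:1502.03050 numbering), with the Correction CMP 359 (2018) 821] -/
theorem meanField_core [DecidableRel G.Adj] {β h : ℝ} (hβ : 0 ≤ β) (hh : 0 ≤ h) {o : V} (ho : o ∈ Λ)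
    {c : ℝ} (hc0 : 0 ≤ c) (hc : ∀ y ∈ Λ, c * isingCorr G Λ β h .free {y} ≤ isingCorr G Λ β h .free {o}) :
    c * ∑ S' ∈ Λ.powerset.filter (fun S' => o ∈ S'),
        (dctW G Λ (ghostCoupling β (β * h)) S').toReal / (Zg[ghostCoupling β (β * h), ∅]).toReal ^ 2 *
          ∑ x ∈ S', ∑ _y ∈ (Λ \ S').filter (G.Adj x), isingCorr G S' β 0 .free ({o} ∆ {x}) ≤
      isingCorr G Λ β h .free {o} *
        ∑ e ∈ edgesIn G Λ, Sym2.lift ⟨fun x y => isingCorr G Λ β h .free ({o} ∆ ({x} ∆ {y})) -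
          isingCorr G Λ β h .free {o} * isingCorr G Λ β h .free ({x} ∆ {y}),
          fun x y => by simp only [symmDiff_comm ({x} : Finset V) {y}]⟩ e := by
  set θ : Sym2 (Option V) → ℝ := ghostCoupling β (β * h) with hθdef
  set Z : ℝ := (Zg[θ, ∅]).toReal with hZ
  set δ : V → V → ℝ := fun x y => (dctDelta G Λ θ o x y).toReal / Z ^ 2 with hδ
  set r : V → V → ℝ := fun x y =>
    (currentPairSum G Λ θ (starSet ({o} ∆ {x})) ∅ (fun m => ind (¬Conn[m, some o, none] ∧ Conn[m, some y, none]))).toReal / Z ^ 2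
    with hr
  -- Step 1: the pairwise inequality
  have hpair : ∀ x ∈ Λ, ∀ y ∈ Λ.filter (G.Adj x), c * r x y ≤ isingCorr G Λ β h .free {o} * δ x y := by
    intro x hx y hy
    rw [mem_filter] at hy
    have hxy : x ≠ y := G.ne_of_adj hy.2
    have h1 : r x y ≤ isingCorr G Λ β h .free {y} * δ x y := claim1_toReal hβ hh ho hx hy.1 hxy
    have hδ0 : 0 ≤ δ x y := div_nonneg ENNReal.toReal_nonneg (sq_nonneg _)
    calc c * r x y ≤ c * (isingCorr G Λ β h .free {y} * δ x y) := mul_le_mul_of_nonneg_left h1 hc0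
      _ = (c * isingCorr G Λ β h .free {y}) * δ x y := by ring
      _ ≤ isingCorr G Λ β h .free {o} * δ x y := mul_le_mul_of_nonneg_right (hc y hy.1) hδ0
  -- Step 2: sum over ordered adjacent pairs
  have hsum : c * ∑ x ∈ Λ, ∑ y ∈ Λ.filter (G.Adj x), r x y ≤
      isingCorr G Λ β h .free {o} * ∑ x ∈ Λ, ∑ y ∈ Λ.filter (G.Adj x), δ x y := by
    rw [mul_sum, mul_sum]
    refine sum_le_sum fun x hx => ?_
    rw [mul_sum, mul_sum]
    exact sum_le_sum fun y hy => hpair x hx y hy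
  -- Step 3: the right-hand side is the edge sum
  have hR : ∑ x ∈ Λ, ∑ y ∈ Λ.filter (G.Adj x), δ x y =
      ∑ e ∈ edgesIn G Λ, Sym2.lift ⟨fun x y => isingCorr G Λ β h .free ({o} ∆ ({x} ∆ {y})) -
        isingCorr G Λ β h .free {o} * isingCorr G Λ β h .free ({x} ∆ {y}),
        fun x y => by simp only [symmDiff_comm ({x} : Finset V) {y}]⟩ e := by
    rw [sum_adj_eq_sum_edgesIn]
    refine sum_congr rfl fun e he => ?_
    induction e using Sym2.ind with
    | _ x y =>
      obtain ⟨hadj, hmem⟩ := mem_edgesIn_iff.1 he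
      have hxy : x ≠ y := G.ne_of_adj ((SimpleGraph.mem_edgeSet G).1 hadj)
      rw [Sym2.lift_mk, Sym2.lift_mk]
      simp only [hδ]
      rw [isingCorr_triple_sub_eq_dctDelta hβ hh ho (hmem x (Sym2.mem_mk_left x y))
        (hmem y (Sym2.mem_mk_right x y)) hxy, add_div]
  -- Step 4: the left-hand side, rearranged
  have hLterm : ∀ x ∈ Λ, ∀ y ∈ Λ.filter (G.Adj x), r x y =
      ∑ S' ∈ Λ.powerset.filter (fun S' => o ∈ S' ∧ y ∉ S' ∧ x ∈ S'),
        isingCorr G S' β 0 .free ({o} ∆ {x}) * ((dctW G Λ θ S').toReal / Z ^ 2) := by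
    intro x hx y hy
    rw [mem_filter] at hy
    simp only [hr]
    rw [currentPairSum_notConn_conn_toReal_eq hβ hh ho hx hy.1, sum_div]
    exact sum_congr rfl fun S' _ => by ring
  have hL : ∑ x ∈ Λ, ∑ y ∈ Λ.filter (G.Adj x), r x y =
      ∑ S' ∈ Λ.powerset.filter (fun S' => o ∈ S'),
        (dctW G Λ θ S').toReal / Z ^ 2 * ∑ x ∈ S', ∑ _y ∈ (Λ \ S').filter (G.Adj x), isingCorr G S' β 0 .free ({o} ∆ {x}) := by
    rw [sum_congr rfl fun x hx => sum_congr rfl fun y hy => hLterm x hx y hy]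
    -- write all filters as indicators and exchange the sums
    have step : ∀ x ∈ Λ, ∀ y ∈ Λ.filter (G.Adj x),
        ∑ S' ∈ Λ.powerset.filter (fun S' => o ∈ S' ∧ y ∉ S' ∧ x ∈ S'),
          isingCorr G S' β 0 .free ({o} ∆ {x}) * ((dctW G Λ θ S').toReal / Z ^ 2) =
        ∑ S' ∈ Λ.powerset.filter (fun S' => o ∈ S'),
          if y ∉ S' ∧ x ∈ S' then isingCorr G S' β 0 .free ({o} ∆ {x}) * ((dctW G Λ θ S').toReal / Z ^ 2) else 0 := by
      intro x _ y _
      rw [← sum_filter, filter_filter]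
    rw [sum_congr rfl fun x hx => sum_congr rfl fun y hy => step x hx y hy]
    rw [sum_congr rfl fun x _ => sum_comm, sum_comm]
    refine sum_congr rfl fun S' hS' => ?_
    rw [mem_filter, mem_powerset] at hS'
    rw [mul_sum]
    -- restrict `x` to `S'` and `y` to `Λ ∖ S'`
    rw [← sum_filter_add_sum_filter_not Λ (fun x => x ∈ S')]
    have hz : ∑ x ∈ Λ.filter (fun x => x ∉ S'), ∑ y ∈ Λ.filter (G.Adj x),
        (if y ∉ S' ∧ x ∈ S' then isingCorr G S' β 0 .free ({o} ∆ {x}) * ((dctW G Λ θ S').toReal / Z ^ 2) else 0) = 0 :=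
      sum_eq_zero fun x hx => sum_eq_zero fun y _ => if_neg fun h => (mem_filter.1 hx).2 h.2
    rw [hz, add_zero, filter_mem_eq_inter, inter_eq_right.2 hS'.1]
    refine sum_congr rfl fun x hx => ?_
    rw [mul_sum, ← sum_filter]
    have hset : (Λ.filter (G.Adj x)).filter (fun y => y ∉ S' ∧ x ∈ S') = (Λ \ S').filter (G.Adj x) := by
      ext y
      simp only [mem_filter, mem_sdiff]
      tauto
    rw [hset]
    exact sum_congr rfl fun y _ => by ring
  rw [hL, hR] at hsum
  exact hsum

/-! ### The derivative of `⟨σ_o⟩` in Duminil-Copin–Tassion's parametrisation -/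

/-- The Boltzmann weight in DCT's parametrisation: at the tree parameters `(s, h/s)` (`s ≠ 0`) the
weight is `exp(s ∑_e σ_e + h ∑_x σ_x)`. [cite: DuminilCopinTassionCMP2016, §2.1 "Notation" (arXiv:1502.03050 numbering)] -/
theorem isingWeight_free_dctParam (h : ℝ) {s : ℝ} (hs : s ≠ 0) (τ : Λ → ℤˣ) :
    isingWeight G Λ s (h / s) .free τ =
      Real.exp (s * (∑ e ∈ edgesIn G Λ, bondSpin (glue Λ τ .free) e) + h * ∑ x ∈ Λ, spinAt x (glue Λ τ .free)) := by
  unfold isingWeight isingHamiltonian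
  rw [interactionEdges_free]
  congr 1
  field_simp
  ring

/-- **The `β`-derivative of `⟨σ_o⟩_{Λ,β,h}` at fixed `h` in DCT's parametrisation** (Duminil-Copin–
Tassion 2016, proof of Lemma 2.6, first display: "The derivative of `⟨σ₀⟩_{Λ,β,h}` is given by
`d/dβ ⟨σ₀⟩ = ∑_{{x,y} ⊂ Λ} J_{x,y} (⟨σ₀σ_xσ_y⟩ - ⟨σ₀⟩⟨σ_xσ_y⟩)`"): for `β ≠ 0`,
`d/dβ ⟨σ_o⟩^∅_{Λ;β,h/β} = ∑_{e ∈ ℰ_Λ} (⟨σ_oσ_e⟩ - ⟨σ_o⟩⟨σ_e⟩)_{Λ;β,h/β}`. [cite: DuminilCopinTassionCMP2016, proof of Lemma 2.6, first display (arXiv:1502.03050 numbering)] -/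
theorem hasDerivAt_isingExpect_spinAt_dctParam (o : V) (h : ℝ) {β : ℝ} (hβ : β ≠ 0) :
    HasDerivAt (fun s => isingExpect G Λ s (h / s) .free (spinAt o))
      (∑ e ∈ edgesIn G Λ, (isingExpect G Λ β (h / β) .free (fun σ => bondSpin σ e * spinAt o σ) -
        isingExpect G Λ β (h / β) .free (fun σ => bondSpin σ e) * isingExpect G Λ β (h / β) .free (spinAt o))) β := by
  set B : (Λ → ℤˣ) → ℝ := fun τ => ∑ e ∈ edgesIn G Λ, bondSpin (glue Λ τ .free) e with hB
  set M : (Λ → ℤˣ) → ℝ := fun τ => ∑ x ∈ Λ, spinAt x (glue Λ τ .free) with hM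
  set w : ℝ → (Λ → ℤˣ) → ℝ := fun s τ => Real.exp (s * B τ + h * M τ) with hw
  have hwt : ∀ {s : ℝ}, s ≠ 0 → ∀ τ, isingWeight G Λ s (h / s) .free τ = w s τ := fun hs τ =>
    isingWeight_free_dctParam h hs τ
  have hw' : ∀ τ, HasDerivAt (fun s => w s τ) (B τ * w β τ) β := by
    intro τ
    have h1 : HasDerivAt (fun s : ℝ => s * B τ + h * M τ) (B τ) β := by
      simpa using ((hasDerivAt_id β).mul_const (B τ)).add_const (h * M τ)
    exact h1.exp.congr_deriv (by simp only [hw]; ring)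
  -- the expectation as a quotient of `w`-sums near `β`
  have hE : ∀ {s : ℝ}, s ≠ 0 → ∀ {f : SpinConfig V → ℝ}, Measurable f →
      isingExpect G Λ s (h / s) .free f = (∑ τ : Λ → ℤˣ, w s τ * f (glue Λ τ .free)) / ∑ τ : Λ → ℤˣ, w s τ := by
    intro s hs f hf
    rw [isingExpect_eq_sum_div G Λ (h / s) .free s hf, isingPartitionFunction]
    simp only [hwt hs]
  have hev : (fun s => isingExpect G Λ s (h / s) .free (spinAt o)) =ᶠ[nhds β]
      fun s => (∑ τ : Λ → ℤˣ, w s τ * spinAt o (glue Λ τ .free)) / ∑ τ : Λ → ℤˣ, w s τ := by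
    filter_upwards [isOpen_ne.mem_nhds hβ] with s hs
    exact hE hs (measurable_spinAt o)
  have hN : HasDerivAt (fun s => ∑ τ : Λ → ℤˣ, w s τ * spinAt o (glue Λ τ .free))
      (∑ τ : Λ → ℤˣ, B τ * w β τ * spinAt o (glue Λ τ .free)) β :=
    HasDerivAt.fun_sum fun τ _ => (hw' τ).mul_const _
  have hD : HasDerivAt (fun s => ∑ τ : Λ → ℤˣ, w s τ) (∑ τ : Λ → ℤˣ, B τ * w β τ) β :=
    HasDerivAt.fun_sum fun τ _ => hw' τ
  have hZpos : 0 < ∑ τ : Λ → ℤˣ, w β τ := sum_pos (fun τ _ => Real.exp_pos _) univ_nonempty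
  refine ((hN.div hD hZpos.ne').congr_of_eventuallyEq hev).congr_deriv ?_
  -- identify the derivative
  have mb : ∀ e, Measurable fun σ : SpinConfig V => bondSpin σ e := fun e => measurable_bondSpin e
  have e1 : ∀ e, isingExpect G Λ β (h / β) .free (fun σ => bondSpin σ e * spinAt o σ) =
      (∑ τ : Λ → ℤˣ, w β τ * (bondSpin (glue Λ τ .free) e * spinAt o (glue Λ τ .free))) / ∑ τ : Λ → ℤˣ, w β τ :=
    fun e => hE hβ ((mb e).mul (measurable_spinAt o))
  have e2 : ∀ e, isingExpect G Λ β (h / β) .free (fun σ => bondSpin σ e) =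
      (∑ τ : Λ → ℤˣ, w β τ * bondSpin (glue Λ τ .free) e) / ∑ τ : Λ → ℤˣ, w β τ := fun e => hE hβ (mb e)
  have e3 : isingExpect G Λ β (h / β) .free (spinAt o) =
      (∑ τ : Λ → ℤˣ, w β τ * spinAt o (glue Λ τ .free)) / ∑ τ : Λ → ℤˣ, w β τ := hE hβ (measurable_spinAt o)
  simp only [e1, e2, e3]
  rw [sum_sub_distrib, ← sum_div, ← sum_mul, ← sum_div]
  have hB1 : ∑ e ∈ edgesIn G Λ, ∑ τ : Λ → ℤˣ, w β τ * (bondSpin (glue Λ τ .free) e * spinAt o (glue Λ τ .free)) =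
      ∑ τ : Λ → ℤˣ, B τ * w β τ * spinAt o (glue Λ τ .free) := by
    rw [sum_comm]
    refine sum_congr rfl fun τ _ => ?_
    simp only [hB, sum_mul]
    exact sum_congr rfl fun e _ => by ring
  have hB2 : ∑ e ∈ edgesIn G Λ, ∑ τ : Λ → ℤˣ, w β τ * bondSpin (glue Λ τ .free) e = ∑ τ : Λ → ℤˣ, B τ * w β τ := by
    rw [sum_comm]
    refine sum_congr rfl fun τ _ => ?_
    simp only [hB, sum_mul]
    exact sum_congr rfl fun e _ => by ring
  rw [hB1, hB2]
  field_simp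

/-- The same derivative with the edge terms as correlations: for `e = {x,y}`,
`⟨σ_oσ_e⟩ = ⟨σ_{{o}∆{x}∆{y}}⟩`, `⟨σ_e⟩ = ⟨σ_{{x}∆{y}}⟩`. [cite: DuminilCopinTassionCMP2016, proof of Lemma 2.6, first display (arXiv:1502.03050 numbering)] -/
theorem hasDerivAt_isingCorr_singleton_dctParam (o : V) (h : ℝ) {β : ℝ} (hβ : β ≠ 0) :
    HasDerivAt (fun s => isingCorr G Λ s (h / s) .free {o})
      (∑ e ∈ edgesIn G Λ, Sym2.lift ⟨fun x y => isingCorr G Λ β (h / β) .free ({o} ∆ ({x} ∆ {y})) -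
          isingCorr G Λ β (h / β) .free {o} * isingCorr G Λ β (h / β) .free ({x} ∆ {y}),
          fun x y => by simp only [symmDiff_comm ({x} : Finset V) {y}]⟩ e) β := by
  have hfun : (fun s => isingCorr G Λ s (h / s) .free {o}) = fun s => isingExpect G Λ s (h / s) .free (spinAt o) := by
    funext s
    simp only [isingCorr]
    congr 1
    funext σ; simp [spinProduct]
  rw [hfun]
  refine (hasDerivAt_isingExpect_spinAt_dctParam o h hβ).congr_deriv (sum_congr rfl fun e he => ?_)
  induction e using Sym2.ind with
  | _ x y =>
    rw [Sym2.lift_mk]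
    have h1 : (fun σ : SpinConfig V => bondSpin σ s(x, y) * spinAt o σ) = spinProduct ({o} ∆ ({x} ∆ {y})) := by
      funext σ
      rw [bondSpin_mk, ← spinPair, spinPair_eq_spinProduct_symmDiff, mul_comm, spinAt_mul_spinProduct,
        symmDiff_comm]
    have h2 : (fun σ : SpinConfig V => bondSpin σ s(x, y)) = spinProduct ({x} ∆ {y}) := by
      funext σ
      rw [bondSpin_mk, ← spinPair, spinPair_eq_spinProduct_symmDiff]
    have h3 : (spinAt o : SpinConfig V → ℝ) = spinProduct {o} := by
      funext σ; simp [spinProduct]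
    rw [h1, h2, h3]
    simp only [isingCorr]
    ring

omit [G.LocallyFinite] in
/-- Exchanging a sum over subsets `S ⊆ Λ` with a property and a sum over their elements. [folklore] -/
theorem sum_powerset_filter_sum_mem (p : Finset V → Prop) [DecidablePred p] (g : Finset V → V → ℝ) :
    ∑ S ∈ Λ.powerset.filter p, ∑ x ∈ S, g S x =
      ∑ x ∈ Λ, ∑ S ∈ Λ.powerset.filter (fun S => p S ∧ x ∈ S), g S x := by
  have h1 : ∀ S ∈ Λ.powerset.filter p, ∑ x ∈ S, g S x = ∑ x ∈ Λ, if x ∈ S then g S x else 0 := by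
    intro S hS
    rw [mem_filter, mem_powerset] at hS
    rw [← sum_filter, filter_mem_eq_inter, inter_eq_right.2 hS.1]
  rw [sum_congr rfl h1, sum_comm]
  refine sum_congr rfl fun x _ => ?_
  rw [← sum_filter, filter_filter]

end Core

end Literature.Probability.LatticeModels

/-! ## The mean-field differential inequality on `ℤ^d` (discharge of the named fact) -/

namespace Literature.Probability.LatticeModels

open Percolation GKSInequalities

variable {d : ℕ}

/-- The splitting of `φ_β(S)` according to whether the outside neighbour lies in `Λ` (the origin of
the correcting term of the 2018 Correction: "the summation on `y ∉ S` … should be understood as a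
summation on `y ∈ Λ ∖ S`"): for `S ⊆ Λ`,
`tanh β ∑_{x ∈ S} ∑_{y ∈ Λ∖S, y ∼ x} ⟨σ₀σ_x⟩_{S,β,0} = φ_β(S) - tanh β ∑_{x ∈ S} #{y ∼ x, y ∉ Λ} ⟨σ₀σ_x⟩_{S,β,0}`. [cite: DuminilCopinTassionCMP2016, Correction CMP 359 (2018) 821] -/
theorem tanh_mul_sum_eq_dctIsingPhi_sub {β : ℝ} {S Λ : Finset (Site d)} (hS : S ⊆ Λ) :
    Real.tanh β * ∑ x ∈ S, ∑ _y ∈ (Λ \ S).filter ((zdGraph d).Adj x), isingCorr (zdGraph d) S β 0 .free ({0} ∆ {x}) =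
      dctIsingPhi d β S -
        Real.tanh β * ∑ x ∈ S, #(((zdGraph d).neighborFinset x).filter (fun y => y ∉ Λ)) *
          isingCorr (zdGraph d) S β 0 .free ({0} ∆ {x}) := by
  rw [dctIsingPhi, eq_sub_iff_add_eq, mul_sum, mul_sum, ← sum_add_distrib]
  refine sum_congr rfl fun x _ => ?_
  rw [sum_const, sum_const, nsmul_eq_mul, nsmul_eq_mul, isingTwoPoint, spinPair_eq_spinProduct_symmDiff, ← isingCorr]
  have hsplit : #(((zdGraph d).neighborFinset x).filter (fun y => y ∉ S)) =
      #((Λ \ S).filter ((zdGraph d).Adj x)) + #(((zdGraph d).neighborFinset x).filter (fun y => y ∉ Λ)) := by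
    rw [← card_union_of_disjoint]
    · congr 1
      ext y
      simp only [mem_filter, mem_union, mem_sdiff, SimpleGraph.mem_neighborFinset]
      have : y ∈ S → y ∈ Λ := fun h => hS h
      tauto
    · rw [disjoint_left]
      intro y h1 h2
      exact (mem_filter.1 h2).2 (mem_sdiff.1 (mem_filter.1 h1).1).1
  rw [hsplit, Nat.cast_add]
  ring

/-- `c(Λ) ⟨σ_y⟩_Λ ≤ ⟨σ₀⟩_Λ` for `y ∈ Λ` (`β, h > 0`). [folklore] -/
theorem dctRatioConst_mul_le {Λ : Finset (Site d)} {β h : ℝ} (hβ : 0 < β) (hh : 0 < h) {y : Site d}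
    (hy : y ∈ Λ) : dctRatioConst d Λ β h * dctCorr d Λ β h {y} ≤ dctMag d Λ β h := by
  have hpos := dctCorr_singleton_pos hy hβ hh
  have hle : dctRatioConst d Λ β h ≤ dctMag d Λ β h / dctCorr d Λ β h {y} := by
    unfold dctRatioConst
    exact csInf_le (Set.Finite.image _ (finite_toSet Λ)).bddBelow (Set.mem_image_of_mem _ (mem_coe.2 hy))
  rwa [le_div_iff₀ hpos] at hle

/-- **Duminil-Copin–Tassion 2016, Lemma 2.6 (mean-field differential inequality), as corrected in
CMP 359 (2018) 821 — proved.** For the nearest-neighbour Ising model on `ℤ^d`, `d ≥ 1`, `β > 0`,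
`h > 0` and a finite `Λ ∋ 0`,
`d/dβ ⟨σ₀⟩²_{Λ,β,h} ≥ (2c(Λ)/β)(inf_{S ∋ 0} φ_β(S))(1 - ⟨σ₀⟩²_{Λ,β,h}) - ε(Λ,β,h)`.
The proof is that of Duminil-Copin–Tassion, §2.4: the random-current representation with ghost
(eq. (2.2)), the switching lemma (Lemma 2.5), the decompositions over `𝒮_0` and `𝒮_g` with Claims 1
and 2, Griffiths' inequality (2.4), `∑_{S ∋ 0} 𝐏⊗𝐏(𝒮_g = S) = 1 - ⟨σ₀⟩²`, `tanh β ≤ β`, and —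
for the correcting term — the summation on `y ∈ Λ ∖ S` with Claim 2 summed over `S` and one more
switching (`sum_isingCorr_zero_mul_dctW_eq`). This discharges the named fact
`dct_meanField_differentialInequality` of `MeanFieldLowerBound`. [cite: DuminilCopinTassionCMP2016, Lemma 2.6 and its proof, §2.4 (arXiv:1502.03050 numbering), with the Correction CMP 359 (2018) 821] -/
theorem dct_meanField_differentialInequality_holds : dct_meanField_differentialInequality (d := d) := by
  intro hd β h hβ hh Λ h0
  have hβ0 : 0 ≤ β := hβ.le
  have hk : 0 ≤ h / β := div_nonneg hh.le hβ0
  set G := zdGraph d with hG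
  -- the derivative
  have hderiv : deriv (fun β' => dctMag d Λ β' h ^ 2) β =
      2 * dctMag d Λ β h * ∑ e ∈ edgesIn (zdGraph d) Λ,
        Sym2.lift ⟨fun x y => isingCorr (zdGraph d) Λ β (h / β) .free ({0} ∆ ({x} ∆ {y})) -
          isingCorr (zdGraph d) Λ β (h / β) .free {0} * isingCorr (zdGraph d) Λ β (h / β) .free ({x} ∆ {y}),
          fun x y => by simp only [symmDiff_comm ({x} : Finset (Site d)) {y}]⟩ e := by
    have hf := (hasDerivAt_isingCorr_singleton_dctParam (G := zdGraph d) (Λ := Λ) (0 : Site d) h hβ.ne').pow 2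
    have := hf.deriv
    simp only [Nat.cast_ofNat, Nat.add_one_sub_one, pow_one] at this
    rw [show (fun β' => dctMag d Λ β' h ^ 2) = (fun s => isingCorr (zdGraph d) Λ s (h / s) .free {0}) ^ 2 from rfl, this]
    rfl
  -- the constant `c(Λ)`
  set c := dctRatioConst d Λ β h with hc
  have hc0 : 0 ≤ c := by
    rw [hc]; unfold dctRatioConst
    refine le_csInf ((coe_nonempty.2 ⟨0, h0⟩).image _) ?_
    rintro r ⟨y, hy, rfl⟩
    exact div_nonneg (dctCorr_singleton_pos h0 hβ hh).le (dctCorr_singleton_pos (mem_coe.1 hy) hβ hh).le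
  have hc1 : c ≤ 1 := dctRatioConst_le_one h0 β h
  have hcE : ∀ y ∈ Λ, c * isingCorr (zdGraph d) Λ β (h / β) .free {y} ≤ isingCorr (zdGraph d) Λ β (h / β) .free {0} :=
    fun y hy => dctRatioConst_mul_le hβ hh hy
  -- the random-current core
  have hcore := meanField_core (G := zdGraph d) (Λ := Λ) hβ0 hk h0 hc0 hcE
  -- shorthands
  set θ : Sym2 (Option (Site d)) → ℝ := ghostCoupling β (β * (h / β)) with hθ
  set Z : ℝ := (gcurrentZ (ghostGraph G Λ) (Finset.insertNone Λ) θ (edgesIn (ghostGraph G Λ) (Finset.insertNone Λ)) ∅).toReal with hZ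
  set P : Finset (Site d) → ℝ := fun S' => (dctW G Λ θ S').toReal / Z ^ 2 with hP
  set t : Finset (Site d) → Site d → ℝ := fun S' x => isingCorr G S' β 0 .free ({0} ∆ {x}) with ht
  set N : Site d → ℝ := fun x => #(((zdGraph d).neighborFinset x).filter (fun y => y ∉ Λ)) with hN
  set F0 := Λ.powerset.filter (fun S' => (0 : Site d) ∈ S') with hF0
  set E0 := dctMag d Λ β h with hE0
  have hP0 : ∀ S', 0 ≤ P S' := fun S' => div_nonneg ENNReal.toReal_nonneg (sq_nonneg _)
  have ht0 : ∀ S' ∈ F0, ∀ x ∈ S', 0 ≤ t S' x := by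
    intro S' hS' x hx
    rw [hF0, mem_filter] at hS'
    simp only [ht]
    rw [isingCorr, ← spinPair_eq_spinProduct_symmDiff, ← isingTwoPoint]
    exact isingTwoPoint_free_nonneg (Literature.Probability.LatticeModels.GKSInequalities.gks_one_holds (zdGraph d)) hβ0 hS'.2 hx
  -- (R1)
  have hR1 : ∑ S' ∈ F0, P S' = 1 - E0 ^ 2 := by
    simp only [hP, hF0, hE0]
    rw [← sum_div]
    exact sum_dctW_toReal_eq (G := zdGraph d) (Λ := Λ) hβ0 hk h0
  -- (R2): the correcting term
  have hErr : ∑ S' ∈ F0, P S' * ∑ x ∈ S', N x * t S' x = dctBoundaryError d Λ β h / 2 := by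
    have h1 : ∑ S' ∈ F0, P S' * ∑ x ∈ S', N x * t S' x = ∑ S' ∈ F0, ∑ x ∈ S', N x * (t S' x * P S') := by
      refine sum_congr rfl fun S' _ => ?_
      rw [mul_sum]
      exact sum_congr rfl fun x _ => by ring
    rw [h1, hF0, sum_powerset_filter_sum_mem]
    have h2 : ∀ x ∈ Λ, ∑ S' ∈ Λ.powerset.filter (fun S' => (0 : Site d) ∈ S' ∧ x ∈ S'), N x * (t S' x * P S') =
        N x * (dctCorr d Λ β h ({0} ∆ {x}) - dctMag d Λ β h * dctCorr d Λ β h {x}) := by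
      intro x hx
      rw [← mul_sum, dctCorr, dctMag, dctCorr, dctCorr, ← sum_isingCorr_zero_mul_dctW_eq (G := zdGraph d) (Λ := Λ) hβ0 hk h0 hx,
        sum_div]
      simp only [ht, hP]
      congr 1
      exact sum_congr rfl fun S' _ => by ring
    rw [sum_congr rfl h2, dctBoundaryError]
    simp only [sum_const, nsmul_eq_mul, hN]
    ring
  -- the splitting of `φ`
  have hsplit : ∀ S' ∈ F0, Real.tanh β * ∑ x ∈ S', ∑ _y ∈ (Λ \ S').filter ((zdGraph d).Adj x), t S' x =
      dctIsingPhi d β S' - Real.tanh β * ∑ x ∈ S', N x * t S' x := by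
    intro S' hS'
    rw [hF0, mem_filter, mem_powerset] at hS'
    exact tanh_mul_sum_eq_dctIsingPhi_sub hS'.1
  -- (ii): the infimum
  have hbdd : BddBelow (Set.range fun S : {S : Finset (Site d) // (0 : Site d) ∈ S} => dctIsingPhi d β S.1) := by
    refine ⟨0, ?_⟩
    rintro r ⟨S, rfl⟩
    exact dctIsingPhi_nonneg (Literature.Probability.LatticeModels.GKSInequalities.gks_one_holds (zdGraph d)) hβ0 S.2
  have hinf : ∀ S' ∈ F0, (⨅ S : {S : Finset (Site d) // (0 : Site d) ∈ S}, dctIsingPhi d β S.1) ≤ dctIsingPhi d β S' := by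
    intro S' hS'
    rw [hF0, mem_filter] at hS'
    exact ciInf_le hbdd ⟨S', hS'.2⟩
  set I := ⨅ S : {S : Finset (Site d) // (0 : Site d) ∈ S}, dctIsingPhi d β S.1 with hI
  have hA : I * (1 - E0 ^ 2) ≤ ∑ S' ∈ F0, P S' * dctIsingPhi d β S' := by
    rw [← hR1, mul_sum]
    exact sum_le_sum fun S' hS' => by
      rw [mul_comm]
      exact mul_le_mul_of_nonneg_left (hinf S' hS') (hP0 S')
  -- combine
  set L := ∑ S' ∈ F0, P S' * ∑ x ∈ S', ∑ _y ∈ (Λ \ S').filter ((zdGraph d).Adj x), t S' x with hL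
  have hL0 : 0 ≤ L := sum_nonneg fun S' hS' => mul_nonneg (hP0 S')
    (sum_nonneg fun x hx => sum_nonneg fun _ _ => ht0 S' hS' x hx)
  have hLsplit : Real.tanh β * L = ∑ S' ∈ F0, P S' * dctIsingPhi d β S' - Real.tanh β * (dctBoundaryError d Λ β h / 2) := by
    rw [← hErr, hL, mul_sum, mul_sum, ← sum_sub_distrib]
    refine sum_congr rfl fun S' hS' => ?_
    rw [mul_left_comm, hsplit S' hS']
    ring
  have hcoreL : c * L ≤ E0 * ∑ e ∈ edgesIn (zdGraph d) Λ,
      Sym2.lift ⟨fun x y => isingCorr (zdGraph d) Λ β (h / β) .free ({0} ∆ ({x} ∆ {y})) -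
        isingCorr (zdGraph d) Λ β (h / β) .free {0} * isingCorr (zdGraph d) Λ β (h / β) .free ({x} ∆ {y}),
        fun x y => by simp only [symmDiff_comm ({x} : Finset (Site d)) {y}]⟩ e := hcore
  have htanh : Real.tanh β ≤ β := Literature.Barriers.HubbardSuperconductivity.tanh_le_self hβ0
  have htanh0 : 0 ≤ Real.tanh β := tanh_nonneg hβ0
  have hε : 0 ≤ dctBoundaryError d Λ β h := dctBoundaryError_nonneg h0 hβ0 hh.le
  -- make the abbreviations opaque for the final arithmetic
  set A := ∑ S' ∈ F0, P S' * dctIsingPhi d β S' with hAdef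
  set ε := dctBoundaryError d Λ β h with hεdef
  set D := ∑ e ∈ edgesIn (zdGraph d) Λ,
      Sym2.lift ⟨fun x y => isingCorr (zdGraph d) Λ β (h / β) .free ({0} ∆ ({x} ∆ {y})) -
        isingCorr (zdGraph d) Λ β (h / β) .free {0} * isingCorr (zdGraph d) Λ β (h / β) .free ({x} ∆ {y}),
        fun x y => by simp only [symmDiff_comm ({x} : Finset (Site d)) {y}]⟩ e with hDdef
  rw [hderiv]
  clear_value A ε D L I E0 c P t N
  -- `2 E0 D ≥ 2 c L ≥ (2c/β) tanh β L = (2c/β)(A - tanh β ε/2) ≥ (2c/β) I (1 - E0²) - ε`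
  have h2c : 0 ≤ 2 * c / β := div_nonneg (mul_nonneg zero_le_two hc0) hβ0
  have step1 : 2 * c / β * (Real.tanh β * L) ≤ 2 * (c * L) := by
    rw [show 2 * c / β * (Real.tanh β * L) = (Real.tanh β / β) * (2 * (c * L)) by field_simp]
    refine mul_le_of_le_one_left (mul_nonneg zero_le_two (mul_nonneg hc0 hL0)) ?_
    rw [div_le_one hβ]; exact htanh
  have step2 : 2 * c / β * (I * (1 - E0 ^ 2)) ≤ 2 * c / β * A := mul_le_mul_of_nonneg_left hA h2c
  have step3 : 2 * c / β * (Real.tanh β * (ε / 2)) ≤ ε := by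
    rw [show 2 * c / β * (Real.tanh β * (ε / 2)) = (c * (Real.tanh β / β)) * ε by field_simp]
    refine mul_le_of_le_one_left hε ?_
    calc c * (Real.tanh β / β) ≤ 1 * 1 :=
          mul_le_mul hc1 ((div_le_one hβ).2 htanh) (div_nonneg htanh0 hβ0) zero_le_one
      _ = 1 := one_mul 1
  have key : 2 * c / β * A = 2 * c / β * (Real.tanh β * L) + 2 * c / β * (Real.tanh β * (ε / 2)) := by
    rw [hLsplit]; ring
  have hfinal : 2 * c / β * (I * (1 - E0 ^ 2)) - ε ≤ 2 * (E0 * D) := by linarith [step1, step2, step3, key, hcoreL]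
  calc 2 * c / β * I * (1 - E0 ^ 2) - ε = 2 * c / β * (I * (1 - E0 ^ 2)) - ε := by ring
    _ ≤ 2 * (E0 * D) := hfinal
    _ = 2 * E0 * D := by ring

end Literature.Probability.LatticeModels
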